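import Mathlib
import HarnessLib
import HarnessLib.Audit
import Summits.QuantumFields.Statement
import Literature.MathematicalPhysics.QuantumFieldTheory.QuasiLocalGaugePerturbation
import Summits.QuantumFields.QCD.Theorems.NestedDissectionSeaThresholdShift
import Summits.QuantumFields.YangMills.Statement

/-!
Route: HeavyThresholdYMBridge

DORMANT since 2026-09-04T23:38:04Z (reconciler: no traction for 5 d (last activity statement-checked at 2026-08-30T22:52:37Z); parked, not closed — `ledger route dormant route-QuantumFields-HeavyThresholdYMBridge --off` to reactivate) — unstaffed, not closed; items shared with open routes are served there. `ledger route dormant <id> --off` reactivates.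

# Route HeavyThresholdYMBridge — all quarks above the threshold — scale-wise constructive decoupling
reduces the HEAVY CORNER of QCDOf 2 ∧ QCDOf 3 to RG-ROBUST SU(3) Yang–Mills (conditional bridge),
completed to the chiral point by ONE explicit light-quark node

It suffices to show X = ThresholdQCD ∧ ChiralCompletion. ThresholdQCD (target #0, the heavy corner):
for N_f = 2 and
N_f = 3 there are a threshold M₀ ≥ 0 and ONE mass-independent regularisation `reg` with
`HasMassScaling` such that for
every mass tuple with ALL m_f > M₀ the body of `QCDOf N_f` holds (IsQCDAlong, non-trivial
non-Gaussian glue, non-decoupled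
flavour-changing pseudoscalars, one gap Δ(m) > 0 of the full Hamiltonian, continuum and lattice).
ChiralCompletion (crux,
rank 3, filed by the route-repair of 2026-08-16 after the statement re-type p117723 `QCDOf := ∃ reg,
HasMassScaling ∧
IsChiralAtZero ∧ ∀ m > 0, body`): EVERY regularisation carrying that heavy body above some M₀
carries it, after ONE
constant re-pin of its flavour-blind critical mass m_crit(k) ↦ m_crit(k) + a_k δ/Z_m(k) (δ = the RGI
offset of the
intrinsic chiral corner of its bare trajectory), at EVERY positive tuple, and is chiral at zero
there. Before the re-type
the audited threshold reading (`qcdOf_iff_threshold`, audit g7: the offset hidden in m_crit was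
witness data) made
ThresholdQCD alone equivalent to the conjunct through the provable support ThresholdShift; the
re-type PINS the offset
(the lattice gap must close as m → 0⁺ on the SAME regularisation), the M₀-shifted heavy
regularisation is provably NOT
chiral at zero once its gap is uniform above M₀ (tree
`not_isChiralAtZero_mcrit_shift_of_uniformGapAbove`), and kill
criterion (v) of the original header fired: the heavy line no longer decides the conjunct by itself.
It is kept as the
SUPPLIER OF THE HEAVY ANCHOR — the only constructive proposal in the tree for the threshold body
that the descent family
(route EulerDescent: HonestHeavyAnchor / RayDescent / ChiralCornerSoftness /
RetypedContinuumComplement; softness also in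
AnomalyRigidity / ChiralSpinWaves) consumes — and the light-quark content the re-type introduced is
named as ONE typed
node, ChiralCompletion, stated in the same-regularisation (universality) form so that ThresholdQCD's
witness stays
load-bearing and the node is NOT a restatement of `QCD` (which only gives SOME chiral
regularisation).
ThresholdQCD is reached by the CONDITIONAL BRIDGE of card heavy-threshold-robust-ym-bridge: choose
M₀ ≫ Λ, run a block RG
for gauge field + Wilson fermions from a_k down to the block scale ℓ₀ = c/M₀ with m_crit(k), Z_m(k)
tuned INSIDE the flow
(FermionicUVFlow), integrate the then-heavy quarks so that the gauge marginal of lattice QCD,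
blocked to scale ℓ₀, is a
density in Bałaban's COERCIVE format — a gauge-invariant, analytic, quasi-local principal functional
A with
cA·S_W(V) ≤ A(V) − A(𝟙) (for the intended member: a smooth coercive interpolation of the
background-field action, the
fibre-infimum A_Bl of the FINE Wilson action under an honest fat averaging, Bałaban CMP 119
(2.12)/(2.23)) at the matched
block coupling, O(1)-bounded analytic quasi-local remainder, local approximately factorising
rough-region factors
(HeavyBlockIntegration) — invoke the named condition in its RG-level consumable form
RobustYangMillsRG (crux #4, rev 3 of
2026-08-17: coercive-format robustness of the gapped phase at one block scale, concluded at BLOCK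
level as uniform time-slab
clustering of the blocked laws) and return to the fine QCD species through the consumer's own fibres
(conditional decoupling
at scale ℓ₀, transfer-matrix gap by dense clustering, OS reconstruction incl. O(4) restoration); the
QCD-side mechanism
is the typed layer-1 node ConstructiveDecouplingRG := RobustYangMillsRG → ThresholdQCD (rendered at
rank 5), the
registered condition is listed as crux YangMills := _root_.YangMills with the transfer
YMUniversality := YangMills →
RobustYangMillsRG (#8). Typed shadows outside the deciding theorem: the D1-level action-universality
cone RobustYangMills
(#2, live crux chain), the lattice-gap shadow of the bridge HeavyLatticeGapFromYM (#5) and the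
β-universality clause
YMLatticeGapAlongAFSequences (support since this repair: a PROVED consequence of #2,
`robustYangMills_imp_ymLatticeGapAlongAFSequences`).
Registered condition (gate `conditional_on`): `YangMills`, the tree's own conjunct — CONSUMED IN THE
RG-ROBUST FORM
RobustYangMillsRG (block-level robustness of the gap over the coercive format class — what
universality says `YangMills`
should mean at one block scale); `YangMills` is necessary for the bridge, RobustYangMillsRG is what
it uses, and the route
says so.
Lean: `ThresholdQCD ∧ ChiralCompletion` — ThresholdQCD = `∀ Nf : ℕ, Nf = 2 ∨ Nf = 3 → ∃ M₀ : ℝ, 0 ≤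
M₀ ∧ ∃ reg : Literature.MathematicalPhysics.QuantumFieldTheory.QCDRegularisation Nf,
reg.HasMassScaling ∧ ∀ m : Fin Nf → ℝ, (∀ f, M₀ < m f) → ∃ (z shift :
Literature.MathematicalPhysics.QuantumFieldTheory.QCDField Nf → ℕ → ℝ) (T :
Literature.MathematicalPhysics.QuantumFieldTheory.OSData
(Literature.MathematicalPhysics.QuantumFieldTheory.QCDField Nf) 4),
Literature.MathematicalPhysics.QuantumFieldTheory.IsQCDAlong (reg.scheme m z shift) T ∧
T.IsNontrivial Literature.MathematicalPhysics.QuantumFieldTheory.QCDField.glue ∧ T.IsNonGaussian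
Literature.MathematicalPhysics.QuantumFieldTheory.QCDField.glue ∧ (∀ f g : Fin Nf, f ≠ g →
T.IsNontrivial (Literature.MathematicalPhysics.QuantumFieldTheory.QCDField.pseudoRe f g)) ∧ ∃ Δ > 0,
T.HasMassGap Δ ∧ (reg.scheme m z shift).HasLatticeMassGap Δ`; ChiralCompletion = the same body
hypothesised above `M₀` for an arbitrary `reg` with `reg.HasMassScaling`, concluding `∃ δ : ℝ, (∀ ε
> 0, ∃ m, (∀ f, 0 < m f) ∧ ¬ (reg.scheme (fun f => m f + δ) 0 0).HasLatticeMassGap ε) ∧ ∀ m, (∀ f, 0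
< m f) → <body at reg.scheme (fun f => m f + δ) z shift>` (decl in the route file).

## Assembly
CRUX-ONLY deciding theorem (D-0027 §2.1), re-elaborated by the route-repair of 2026-08-16 against
the re-typed statement:
`closes : ConstructiveDecouplingRG → YangMills → YMUniversality → ChiralCompletion → QCD`, pure
logic + `ring`, sorry-free,
axioms propext / Classical.choice / Quot.sound (planner Sketch.lean rc 0). Inside the proof #7
YangMills and #8
YMUniversality give #4 RobustYangMillsRG by modus ponens, ConstructiveDecouplingRG gives
ThresholdQCD — per N_f a threshold
M₀, a regularisation reg with HasMassScaling and the heavy body above M₀ —, ChiralCompletion applied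
to (reg, M₀) gives the
corner offset δ, chirality at zero and the body at every positive tuple of the δ-re-pinned
regularisation
`{reg with mcrit := m_crit(k) + a_k δ/Z_m(k)}` (its scheme at m is reg's scheme at m + δ, `ring`;
HasMassScaling reads only
a, Z_m), which is literally the witness ⟨reg_δ, HasMassScaling, IsChiralAtZero, body⟩ of the
re-typed `QCDOf N_f`; N_f = 2
and 3 give `QCD`. The frame item #1 Assembly is restated as ThresholdQCD → ChiralCompletion → QCD (X
→ Statement, provable
now by the same term); the former Assembly ThresholdQCD → ThresholdShift → QCD and the proved
support ThresholdShift (the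
audit-g7 shift) are retired from the deciding role by the re-type — ThresholdShift stays a proved
support. A direct proof
h4 of #4 closes with `hD h4` in place of `hD (hU hYM)`; a direct proof of `QCDOf 2 ∧ QCDOf 3` by the
descent family makes
ChiralCompletion moot and this route `superseded` (kill criterion (v′)).

CONDITIONAL on YangMills — this route is an explicit reduction to that named conjecture (D-0019: crux floor waived).

Rationale: WHY THIS LINE. The statement lets every quark be as heavy as we like relative to Λ (audit g7), and
heavy quarks can do nothing at the QCD scale except renormalise the pure-gauge action:
perturbatively this is the Appelquist–Carazzone decoupling theorem with LEET matching of
Λ-parameters (AppelquistCarazzone1975; Collins2011PQCD §3.9–3.10), non-perturbatively it is what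
every lattice computation assumes and the ALPHA collaboration measured (BrunoEtAl2015HeavySea); here
it is to be made CONSTRUCTIVE scale by scale with the block renormalisation group of Bałaban for the
gauge field (Balaban1988Convergent, Balaban1989LargeFieldII) and of Bałaban–O'Carroll–Schor / Dimock
for lattice fermions (BalabanOcarrollSchor1989, Dimock2022QED3), the critical bare mass being tuned
along the flow as in massless lattice φ⁴₄ (GawedzkiKupiainenMasslessLattice1985) and the heavy modes
integrated by a hopping/random-walk or domain-decomposition expansion at the block scale where it
converges (MontvayMunster1994 §5.1.3; Luscher2003SchwarzDD; FariaDaVeigaOCarroll2009 for the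
strong-coupling precedent). Imported areas: constructive RG (mathematical physics), effective field
theory matching (perturbative QCD), polymer expansions and Dobrushin-type quasi-locality conditions
(statistical mechanics); no spectral or probabilistic reformulation is used because the
non-perturbative core is deliberately NOT attacked: it is isolated as the named condition in its
consumable RG-level form RobustYangMillsRG — since rev 3 (2026-08-17): robustness of the
volume-uniform gap (block-level time-slab clustering) over the COERCIVE Bałaban format class of
block-scale densities — which is what universality says `YangMills` should mean at one block scale
and strictly more than the tree's Wilson-action-only `YangMills`. Route RenormalisedVafaWitten
shares only the ThresholdShift glue; this route is the heavy anchor its admissibility-style cruxes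
could consume. STATEMENT RE-TYPE 2026-08-16 (p117723: `QCDOf := ∃ reg, HasMassScaling ∧
IsChiralAtZero ∧ ∀ m > 0, body`): the additive offset is now PINNED to the chiral point, so the
heavy line reaches only the heavy corner of the conjunct (the M₀-shifted heavy regularisation is
provably not chiral at zero once its gap is uniform above M₀ — tree
`not_isChiralAtZero_mcrit_shift_of_uniformGapAbove`); the light-quark content the re-type introduced
(intrinsic-corner pin, descent in the mass on the SAME scheme, Goldstone softness) is named as ONE
typed crux ChiralCompletion in the same-regularisation (universality) form and is NOT attacked by
this route's mechanism — its designated levers live in the descent family (EulerDescent: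
Feynman–Hellmann/Euler descent of the lattice gap from the heavy anchor, intrinsic-corner pin,
re-typed continuum complement; AnomalyRigidity / ChiralSpinWaves for the softness), for which this
route is the constructive SUPPLIER OF THE HEAVY ANCHOR (the only typed proposal for the threshold
body with a mechanism: block RG + decoupling, conditional on robust YM).

RANKED CRUXES. History: rank 2 RobustYangMills (D1 level) was refuted-misstated on paper three times
in revs 1–3 (witnesses W-mon off-domain-blind analytic norm, W-aniso no hypercubic hypothesis,
W-marg coupling kink, W-alt full-sequence limit, W-pair disconnected cheap polymers ⇒ (h4) range
control) and stands as rev 4; on 2026-08-16 the D1-level consumer ConstructiveDecoupling :=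
RobustYangMills → ThresholdQCD (stmt-14372) was refuted-misstated
(refuter-rattack-stmt-QuantumFields-14372, class restates-the-target: on the trajectory m_crit(k) ≈
−0.434 g₀² < 0 the fermion-integrated weight e^{−β_kS_W}∏_f det D_W(U, m_f(k)) VANISHES on SU(3)^E —
Adams 2001, doi:10.1063/1.1415087, index-1 transcripts + free index 0 + continuity; tree
WilsonDeterminantSign — is SIGNED for N_f = 3, carries O(1) cutoff-scale terms per fine plaquette
(T-sup: δβ_k → −∞), and no fermion b.c. is both time-only-antiperiodic-RP and axis-symmetric, so no
element of D1's bounded sup-small fine-lattice cone is at bounded log-density distance and #2 was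
consumable only at W ≡ 0). THE THIRD REPAIR (route-repair seat 657446b1, 2026-08-16) re-pointed the
bridge to the RG level: new crux #4 RobustYangMillsRG (typed over D1 instantiated on the BLOCK
lattice = D1′(2)), #3 replaced by the new item ConstructiveDecouplingRG := RobustYangMillsRG →
ThresholdQCD (rank 5: the gate renders decls in rank order and a decl may only cite lower ranks; the
D1-level ConstructiveDecoupling, stmt-14372, is dropped), #8 restated 1:1 (same decl name) as
YMUniversality := YangMills → RobustYangMillsRG, deciding theorem `closes : ConstructiveDecouplingRG
→ YangMills → YMUniversality → QCD` re-certified; #2 stays as the D1-level action-universality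
shadow (shared with NestedDissectionSea / AdaptiveBlockFermions, live crux chain). The new condition
is NOT the refuter's verbatim C′ (analytic norm on small-field block domains + one-sided floor +
spatial-only permutations): the planner's paper analysis (NOTES.md T1–T7) found that cone
junk-admitting (S-normalised mixtures ½σ + ½c_{k,S}σe^{−KN_def} and far-defect exclusion patterns
have analytic norm 0 on small fields, respect a floor, are RP and lattice-invariant, and have
long-range order — W-mon redux), fermion-excluding in its σ_YM-relative form (QCD at the matched
coupling suppresses maximally rough block fields LESS than YM_{β_eff} because above the quark mass
the coupling runs with N_f flavours: log-ratio ≈ +2(b₀(0)−b₀(N_f)) s b_k² log b_k → ∞), and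
E1-breaking under spatial-only permutations (anisotropic couplings); hence the ABSOLUTE format with
two-sided bounded W, local approximately factorising rough-region factor F, full hypercubic symmetry
and SIGNED reflection-positive weights. THE FOURTH REPAIR (this seat, 38b60152, 2026-08-16): #4 rev
1 was refuted-misstated on paper (refuter-rattack-stmt-QuantumFields-14660, ATTACK.md v2): its (h0)
pinned the PRINCIPAL PART of the blocked density to βe·wilsonAction V — the ultralocal Wilson action
OF THE BLOCK FIELD — and normalised the remainder absolutely (η₀, r before β₀, βe ≥ β₀ unbounded),
whereas every RG-blocked weakly coupled gauge weight deviates from the Wilson ray RELATIVELY: the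
classical blocked action of ANY finite-range covariant blocking is off by δ(Bl) > 0 (complex-pole
obstruction: at q* = (π, π, 2.292i, 0) the coarse Wilson covariance has a pole while every
finite-range blocked covariance is finite, min-alias |K̂²| = 2.54…0.22 for b = 2..8) with δ ≈
0.8–0.9 for axial / Bałaban-averaging blockings (Gaussian aliasing sums: stiffness ratio R(q)/R(0⁺)
spreads ×1.1–25.5 axial, ×0.097–0.96 averaging, b = 2..8), so membership held only while βe ≤
C(κ)η₀/(δr²) and the consumer, handed a β₀ with no ceiling, could never certify its weight (14372's
verdict one level up); Bałaban's own format (CMP 119 p. 258 (2.23), read) has principal part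
−g_k⁻²A(U_k(V)), the FINE action of the BACKGROUND (minimal) configuration U_k(V) (p. 256 (2.12);
Balaban1985), with O(1) remainders E_k incl. the coupling renormalisation ((2.24)–(2.28);
Balaban1987RG1). Rev 2 = the refuter's C′ option (A), restated 1:1 under the same decl name:
principal part βe_k·A_Bl(V), A_Bl(V) := ⨅ over the fibre {U : Bl U = V} of the fine Wilson action;
remainder bound B₀ read as an O(1) format constant (∀B₀ ∃β₀); (h1), (h2), F and the conclusions
unchanged; #3 and #8 re-point by name; `closes` untouched. Planner paper checks (NOTES.md): the
bare-to-block running β_k → βe_k from the fluctuation determinants multiplies ∫tr F²[U_min(V)] =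
A_Bl(V)(1 + O(ε/b_k²)) because U_min(V) is smooth at the fine scale even for finite-amplitude block
fields, so the remainder is O(1) uniformly in k and βe, while against βe·wilsonAction V it diverges
like log b_k × (quadratic δ(Bl) + quartic a²F⁴ mismatches); in the Gaussian caricature the blocked
density is EXACTLY exp(−β × classical perfect action) × const, i.e. W ≡ const — the refuter's R(q)
is the Hessian of A_Bl, absorbed by definition; V-independent fluctuation constants rescale w (only
∫w > 0 is asked); ρ(V) ≤ e^{−β_k A_Bl(V)} ≤ e^{−βe A_Bl(V)} (β_k ≥ βe by asymptotic freedom) keeps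
|F| ≤ e^{c₀|Z|} satisfiable and rough blocks Peierls-suppressed by e^{−(βe c′ε − c₀)} (ε, c₀ before
β₀ — essential, present); covariance forces Bl(U)(y, μ) to be a transporter cor y → cor(y + ê_μ)
within range 5b_k, so junk blockings rescale A_Bl by at most a bounded area factor (absorbed in β₀)
and pure-gauge fibres cover one gauge orbit only; for small fields the global fibre-infimum is
Bałaban's regular minimal orbit (a dislocation costs ≥ ε₀ ≫ θ² locally; abelian case: harmonic
extension, exact); other RP asymptotically free fine actions (mixed fundamental–adjoint) block into
the SAME format (difference βe·O(a_k²/ℓ₀²) → 0), so fine-action universality is automatic and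
alternating-k families are absorbed by the subsequence φ of (i′). THE FIFTH REPAIR (route-repair
seat 6d6b7fd6, 2026-08-16T23Z, statement re-type p117723 — kill criterion (v) fired): the former
crux-only `closes` (M₀-shift of ThresholdQCD's witness) stopped elaborating because the witness of
the re-typed `QCDOf` needs `reg.IsChiralAtZero`, unfillable by the shift; the repair (a) filed the
light-quark completion as the new rank-3 crux ChiralCompletion (same-regularisation form, typed over
Literature decls only, planner Sketch.lean rc 0), (b) re-elaborated `closes :
ConstructiveDecouplingRG → YangMills → YMUniversality → ChiralCompletion → QCD` (pure logic +
`ring`, std axioms; the δ-re-pinned regularisation is the witness), (c) restated the frame item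
Assembly := ThresholdQCD → ChiralCompletion → QCD (provable now), (d) re-badged #6
YMLatticeGapAlongAFSequences crux → support (a PROVED consequence of #2: landed
`robustYangMills_imp_ymLatticeGapAlongAFSequences`; the decl stays, landed Theorems cite it) to
respect the cap of 7; a transient `closes` through Assembly + ThresholdShift (rev 19) bridged the
gate's add-before-use ordering. THE SIXTH REPAIR (route-repair seat 0165b161, 2026-08-17): #4 rev 2
(stmt-14958, shared verbatim with NestedDissectionSea) was REFUTED IN LEAN (`not_RobustYangMillsRG`,
p136776, class refuted-misstated; standing disprover + line lead): its AdmAt constrained the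
∃-chosen blocking map only by measurability, covariance and 5b-locality, so a WILD measurable
blocking (straight transport × X^n ζ^j with exponents decoded from a dial plaquette: a Haar→Haar
shear with fibre infimum ≡ 0) made the β = 0 Haar weight admissible for every β₀ (W = 0, F ≡ 1, βe ≡
β₀), against IsNontrivial (tree not_isNontrivial_beta_zero). The refuter's C′ (`Continuous Bl`) was
rejected as insufficient on the lead's repair-caveat (fixed-exponent cousins P·X^n are continuous,
Haar→Haar, with sup A_Bl ≤ CM⁴/n²: label inflation; only exact non-analyticity of the fibre infimum
would fence them), pinning Bl to a tree map was rejected because the tree's only closed-form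
blockings are THIN (LocalGaugeBlocking.spreadAxial, BlockMean.rep; the exp/log fat mean is not
constructed) and thin blockings are physically wrong (FINDINGS-r1-k1 A3: A^thin ∼ S_W/b_k, fine β_k
as coefficient), and the crux-ideate FINDINGS (A4 sub-ℓ₀ blindness; A5 / F-E1 E1 dichotomy:
hypercubic-anisotropic RP families — heavy anisotropic matter, coupling-modulated YM with
product-kernel auxiliary field — are admissible iff the consumers' format theorem holds and then
have no SO(4)-invariant OS limit; F-POS) showed the FINE conclusions (i′),(ii) misstated for the
class. Rev 3 (stmt restated 1:1 under the same decl name; #3, #8 re-point by name; `closes`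
untouched; planner Sketch rc 0, one-line ≡ multi-line by Iff.rfl, simp/aesop probes close neither
side): principal functional over an explicit COERCIVE analytic quasi-local class (refuter option
(B)), blocking an explicit ∀-family, w also gauge-invariant, conclusion at BLOCK level (uniform
time-slab clustering, one Δ, sup-norm-uniform C per slab thickness) — paper junk audit: Haar /
strong coupling (blocked density nearly constant vs βe·cA·ε ≥ 2B₀ per site on the quantised-flux
small-field configuration), pull-backs h∘Bl (fail (h1) for all fine translations), thin and semi-fat
blockings and every X^n device (fail coercivity), Higgs/Coulomb-phase matter (broken-phase matter
integrated out leaves power-law tails: fails e^{−κ|X|} quasi-locality; light matter likewise) are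
all outside; E1 / sub-ℓ₀ / F-POS dissolve because nothing fine is concluded. The
fine/OS/O(4)/non-Gaussianity package moved into #3 (its why-might-fail now names it). Items now: #2
RobustYangMills (rank 2, shared, rev 4, unchanged: openness of the gapped SU(3) Wilson phase in the
coupling-relative, KP-sup-small, range-controlled, RP, lattice-symmetric D1 cone along every a.f.
sequence — see its docstring; why it might fail: open ⊇ SU(3) YM ∧ #6, β- and action-universality
incl. E1, (iv) flagged misstated at coincident smearings, Cruxes/RobustYangMills/FLAG-clause-iv.md;
sources JaffeWitten2000 §5, Balaban1988Convergent, DobrushinShlosman1987). #3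
ConstructiveDecouplingRG (rendered at rank 5, staffing priority of a rank-3 crux) — the QCD-SIDE
HALF: RobustYangMillsRG ⟹ ThresholdQCD; content = constructive Appelquist–Carazzone delivered INTO
the format of #4: the gauge marginal of lattice QCD with Wilson fermions ANTIPERIODIC IN ALL FOUR
DIRECTIONS (hypercubic and link-RP; site-RP from m_f(k) > −1), w = e^{−β_kS_W}∏_f det D_W^{ap}
(signed), satisfies (h1)–(h2) and blocks through Bałaban-averaged transporters at ℓ₀ = c/M₀ into
exp(−β_eff,k A_Bl(V) − W(V))·F(LF(V), V) with A_Bl the fibre-infimum of the FINE Wilson action (the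
log det's log-divergent part renormalises the coefficient of exactly this functional:
CouplingMatching), β_eff the matched N_f = 0 block coupling (β_eff(ℓ₀) ≥ β₀ by taking ℓ₀Λ′ small,
uniformly: the remainder does not grow at weaker coupling), W = YM's O(1) localized terms E_k +
heavy-quark remainder (fermion-induced irrelevant operators O(1/c²) relative, non-local loops
e^{−c}; ‖W‖ ≤ B₀ = O(1) uniformly in k and βe — B₀ is committed first, then β₀(B₀) is met by the
choice of ℓ₀, then M₀ ≥ c/ℓ₀), F = the non-expanded rough-region factor (Schur complements of the
block Dirac operator — zeros and signs live there); then #4 (rev 3) gives UNIFORM TIME-SLAB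
CLUSTERING OF THE BLOCKED LAWS (one Δ, sup-norm-uniform constants) and the FINE package is QCD-side
fibre physics (sixth repair): conditional decoupling given V at rate c/ℓ₀ in the bridge's own
Bałaban/BOS fluctuation fields turns block clustering into fine slab clustering of bounded
observables, the fine transfer-matrix gap follows by dense clustering (Glimm–Jaffe 6.1.3; tree
gapNorm_le_exp_of_dense_clustering, MassGapFromLatticeClustering), subsequential OS limits of the
renormalised fine species by compactness with E0′/E2/E3/E4 and translations inherited and O(4)
ROTATION RESTORATION for the isotropic Wilson family as an explicit added burden,
IsNontrivial/IsNonGaussian glue from asymptotic freedom at short distance; the quark species follow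
by source dressing (E_w[Φ_fine] = E[∂_tW_t] at block level, heavy quark-line representation:
flavoured decay ≥ 2M₀ − O(Λ), IsNontrivial (pseudoRe f g) from the computable two-point function at
|x| ≈ 1/M₀), the per/ap comparison O(e^{−2M₀a_k(2S+1)}) returns to the statement's time-periodic
functional, SignIrrelevance at expectation level for N_f = 3 / split masses, ThresholdShift absorbs
M₀ (why it might fail: block-fermion RG with a dynamical SU(3) field in d = 4 never built — BOS
external-field, Dimock abelian d = 3; m_crit tuned inside the flow; since rev 3 of #4 also the
fine/OS leg — no O(4)-restoration theorem for 4D lattice gauge theories, composite-field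
renormalisation below ℓ₀ —; coercivity of a certified FAT covariant averaging (no exp/log BlockMean
in the tree); small-field POSITIVITY of the blocked det³ weight needs the SU(3) Wilson DISLOCATION
bound 4b₀s_d > 4, i.e. s_d > 16π²/11 ≈ 14.4 in the tree normalisation S = βS_W, instanton 4π² ≈
39.5, cf. doi:10.1016/0370-2693(89)90640-0, doi:10.1016/0370-2693(89)91067-8; exact format
membership — two-sided B₀-bounded analytic W on g-UNIFORM domains (ε, r) against Bałaban's α ∼ g(log
g⁻²)^q, e^{−κn}-local F, single-exponential collapse — may fail; sources AppelquistCarazzone1975,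
BalabanOcarrollSchor1989, Dimock2022QED3, Balaban1988Convergent,
GawedzkiKupiainenMasslessLattice1985, MontvayMunster1994 §5.1, Luscher2003SchwarzDD,
doi:10.1063/1.1415087). NEW #3 ChiralCompletion (rank 3, crux; fifth repair) — THE LIGHT-QUARK
COMPLETION: for N_f ∈ {2,3}, EVERY regularisation reg with HasMassScaling that carries the full body
of QCDOf N_f at every tuple above SOME M₀ (ThresholdQCD's witness) carries it, after ONE constant
re-pin m_crit(k) ↦ m_crit(k) + a_k δ/Z_m(k) (δ ∈ ℝ the RGI offset of the intrinsic chiral corner of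
its bare trajectory; written as reg.scheme (m + δ)), at EVERY positive tuple, and is chiral at zero
there (∀ ε > 0 some positive tuple has no uniform lattice gap ε). Content: (a) CornerPin — the
corner offset δ_k := (m_crit(k) − m_c(β_k))·Z_m(k)/a_k converges (physically forced by IsQCDAlong's
sequential convergence of hadron masses above M₀; m_c(β) = LUB of the non-massive degenerate bare
masses); (b) MassDescent — existence + continuum/lattice gap for every mass between the corner and
M₀ on the SAME (β_k, Z_m(k), L_k) (honest mass-independence of the scheme: Feynman–Hellmann / Euler
descent of the lattice gap from the heavy anchor, UV stability with light dynamical Wilson quarks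
along one sequence); (c) ChiralSoftness — the lattice gap closes at the corner (Goldstone law m_π² ∝
m_q if chiral symmetry breaks, anomaly matching otherwise). NOT implied by `QCD` (which gives SOME
chiral regularisation): a universality statement in the regularisation — every honest heavy-quark
lattice QCD continues to light quarks — keeping ThresholdQCD's witness load-bearing (why it might
fail: contains light-quark Wilson-lattice QCD; false if reg's trajectory meets a weak-coupling
Aoki/first-order lattice artefact at FIXED RGI m > 0 eventually in k (SharpeSingleton1998: both
branches of the dichotomy shrink to the corner in RGI units, so they do not refute the typed clause,
checked at planning), if massless N_f = 2, 3 QCD is gapped with unbroken chiral symmetry (no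
OS-level Goldstone theorem; excluded physically by anomaly matching), or if the flow-tuned m_crit
has no convergent corner offset; sources SharpeSingleton1998, Aoki1984WilsonPhase,
GasserLeutwyler1984, GellmannOakesRenner1968, MontvayMunster1994 §5.1, tHooft1980Naturalness,
EdwardsHellerNarayanan1998). #4 RobustYangMillsRG (rev 3, sixth repair 2026-08-17) — THE NAMED
CONDITION, RG level, COERCIVE FORMAT, BLOCK-LEVEL CONCLUSION (clauses in full in its docstring): for
every format constants (ε, r, B₀ = O(1), κ, c₀, coercivity cA, principal norm A₀) there is β₀ such
that for all scaling data, every ℓ₀ > 0, every convergent block-coupling sequence βe_k ≥ β₀, every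
family of local gauge-covariant measurable blockings Bl_{k,S} (5b_k-local, covariant under g ∘ cor;
an explicit ∀-family, no longer ∃-chosen inside the format) and every family of signed real
fine-torus weights w_{k,S} on (ℤ/(2S+1))⁴ that is eventually measurable with ∫w > 0, (h1) gauge
invariant and invariant under all translations, the time reflection and ALL axis permutations, (h2)
reflection positive, and (h0) blocked by Bl into exp(−βe_k A(V) − W(V))·F(LF_ε(V), V) with the
PRINCIPAL FUNCTIONAL A ranging over the explicit class {gauge-invariant quasi-local polymer
functional on the block lattice, analytic weighted norm ≤ A₀ on smallFieldDomain ρ 1 r ε, real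
weighted norm ≤ A₀, range control, COERCIVE: cA·Σ_p(3 − Re tr V_p) ≤ A(V) − A(𝟙)} (refuter option
(B); the fibre-infimum tie of rev 2 is gone — coercivity is what the fibre infimum of an honest fat
averaging HAS and what every junk blocking lacks), W the O(B₀) analytic quasi-local range-controlled
remainder, F the rough-region set-function as before — HAS uniform time-slab clustering of its
blocked laws: one Δ > 0, for every slab thickness h a constant C, eventually in k for all S ≥ L_k:
|E_w[G₁(V)G₂(τ_tV)] − E_w[G₁(V)]E_w[G₂(τ_tV)]| ≤ C‖G₁‖∞‖G₂‖∞e^{−Δℓ₀t}, V = Bl U, for all bounded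
measurable block observables supported in the time slab [0, h) and all block time-shifts 2t ≤ M;
NOTHING about fine species, OS data, rotations or non-Gaussianity (why it might fail: open ⊇
volume-uniform gap of every weakly coupled coercive-format SU(3) block theory —
universality/openness of the gapped phase with no IR transfer tool; sup-norm-uniform constants need
∫|ρ|/∫ρ ≈ 1 from the format's rough-region suppression; g-uniform (ε, r) against Bałaban's α ∼ g(log
g⁻²)^q (2.28); the class may be EMPTY of intended members until a fat covariant averaging with
coercivity is certified; sources Balaban1988Convergent p. 256–264, Balaban1985Averaging,
Balaban1984Propagators, Balaban1989LargeFieldII Thm 1, Dimock2022QED3 §3–4, DobrushinShlosman1987,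
FriedliVelenik2017 Thm 5.4, HasenfratzNiedermayer1993, OsterwalderSeilerAnnPhys1978 §2,
JaffeWitten2000 §5). #5 HeavyLatticeGapFromYM — typed lattice-gap shadow of the bridge, unchanged
(docstring); #6 YMLatticeGapAlongAFSequences — SUPPORT since the fifth repair (a proved consequence
of #2, `robustYangMills_imp_ymLatticeGapAlongAFSequences`; β-universality calibration rung,
YM-side). #7 YangMills := _root_.YangMills — the REGISTERED CONDITION listed (bridge-only hold),
YM-side, held against duplicate staffing. #8 YMUniversality := YangMills → RobustYangMillsRG — the
universality TRANSFER making #7 load-bearing: (a) Bałaban's UV stability for the inductive CLASS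
(the renormalization transformations map the format to itself, g-uniform constants), to be
strengthened to g-uniform small-field threshold and analyticity radius and to the
single-exponential/rough-region collapse; (b) irrelevance at weak block coupling of O(1)-bounded
quasi-local remainders around a coercive principal functional (Schwarz flattening, landed
`schwarz_flattening`: relative size B₀g²/r², a coupling shift O(B₀/r²) plus coupling-relatively
sup-small rest — the D1 cone of #2 at the block scale; NO E1/rotation clause any more); (c) β- and
representation-universality r ↦ fundamental, ∃ scheme ↦ ∀ scaling data; (d) openness of the gapped
phase = uniform time-slab clustering of the blocked laws (the whole conclusion of #4 rev 3) given
the YM gap (why it might fail: a sparse ∃-witness of YangMills need not transfer; no IR transfer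
tool; (d) with sup-norm-uniform constants is a transfer-matrix-grade statement for block laws that
are not exactly RP; sources Balaban1988Convergent, Balaban1989LargeFieldII, DobrushinShlosman1987,
JaffeWitten2000). Supports: ThresholdShift (PROVED, thresholdShift_proof — retired from the deciding
role by the re-type), CouplingMatching (PROVED, couplingMatching_proof),
YMLatticeGapAlongAFSequences (re-badged, open), MassEquicontinuity (informal). Dropped earlier:
informal FermionicUVFlow / HeavyBlockIntegration (stmt-8882/8883, folded into #3 as layer-2
children), duplicate YangMills support (stmt-14159), UnitaryGroupNotSimple (stmt-10530, discharged);
retired by this repair: the D1-level ConstructiveDecoupling (stmt-14372, dropped, superseded by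
ConstructiveDecouplingRG) and the D1-level reading of YMUniversality (stmt-14097, restated 1:1 under
the same decl name).

TWO-LAYER PLAN. ConstructiveDecouplingRG (#3) ⇐ FermionicUVFlow → HeavyBlockIntegration →
BridgeGlueOS → #3 (glued split, k = 3, typed over the landed D2 WilsonFermionBlockAveraging and D1′
BlockScaleEffectivePerturbation, or over D1″ BalabanFormatDensity once it lands): FermionicUVFlow —
mass-independent β_k (two-loop scaling, b₀(N_f), b₁(N_f)), window-critical flavour-blind m_crit(k)
and Z_m(k) (HasMassScaling) DEFINED inside an interleaved gauge/fermion block RG from a_k to ℓ₀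
(Bałaban covariant averaging, BOS block averaging Q(U) for quarks, exact Grassmann–Gaussian steps),
small/large-field densities bounded uniformly in k and volume, fermionic effective action analytic
in block Grassmann fields with exponentially decaying covariant kernels, block fermion mass O(c) at
the last step; HeavyBlockIntegration — FORMAT MEMBERSHIP at ℓ₀ of the signed all-antiperiodic gauge
marginal: small-field analyticity with g-uniform threshold, two-sided sup-small W, rough-region
set-function with approximate locality/factorisation, small-field positivity of the blocked density
(dislocation bound), heavy quark-line representation; BridgeGlueOS := (outputs ∧ #4) → ThresholdQCD:
source dressing of fine glue and pseudoscalar insertions into block-level dressed observables, E2 of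
the joint family from lattice RP of Wilson fermions (m_f(k) > −1, Lüscher 1977), E4/translations
from #4's block clustering + conditional decoupling in the bridge's own fibres (fine slab clustering
⇒ transfer-matrix gap by dense clustering ⇒ OS gap, tree MassGapFromLatticeClustering), rotations by
an explicit O(4)-RESTORATION input for the isotropic Wilson family (candidate support
RotationRestoration; DavoudiSavage2012-type irrelevance of the hypercubic dimension-6 operators, no
theorem), IsNontrivial/IsNonGaussian glue from short-distance asymptotic freedom, per/ap comparison
of heavy winding lines O(e^{−2M₀a_k(2S+1)}), z, shift of pseudoRe = block-scale Z_P, sign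
bookkeeping, MassEquicontinuity or convergence of the expansions for the ∃ reg ∀ m order (no
response clause in #4, so m-equicontinuity is QCD-side: BerezinMassDerivative).
HeavyLatticeGapFromYM ⇐ QuarkLineDecomposition → GluonicGapTransfer → HeavyLatticeGapFromYM (k = 2).
ChiralCompletion ⇐ CornerPin → MassDescent → ChiralSoftness → ChiralCompletion (k = 3, foreseen, NOT
filed: typed over EulerDescent's decls — RayDescent, ChiralCornerSoftness,
RetypedContinuumComplement — once their hypotheses (pinned anchor) are aligned with ThresholdQCD's
unpinned regularisation through CornerPin; a re-ask of those three as shared items is the preferred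
split). Supports to file when idle: NonDecouplingFreeLoop, BerezinMassDerivative,
SubsequenceRegularisation, AllAntiperiodicRP (link-RP of the all-antiperiodic Wilson determinant
weight, provable now from the tree's OS machinery). Not filed now.

KILL CRITERIA. (i) ¬YMLatticeGapAlongAFSequences (β-universality of the SU(3) lattice gap fails
along some a.f. Wilson sequence) empties HeavyLatticeGapFromYM and falsifies the condition as named
— pivot: restate with the matched sequences only or close `refuted:YMLatticeGapAlongAFSequences` if
the witness is a genuine gapless a.f. trajectory. (ii) A theorem that flavour-blind m_crit(k) cannot
serve split masses to o(a_k/Z_m(k)) breaks ThresholdQCD for N_f ≥ 2 as posed by the statement itself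
— close `refuted:ThresholdQCD` and report to the operator (statement-level finding). (iii)
¬RobustYangMillsRG (rev 3) by an admissible family without uniform block clustering: class misstated
(a junk device in the coercive format — an explicit Haar-type push-forward surviving coercivity, a
pull-back passing (h1), sup-norm-uniformity failing only through ∫|ρ|/∫ρ) ⇒ restate with the missing
structural clause (tighten the principal class, add block-level positivity, or weaken C‖G₁‖∞‖G₂‖∞ to
OS-norms) — SIX misstated refutations on this decl family say the format is scaffolding and will
move again; class substantive (a genuine coercive-format family in a massless phase reachable above
every β₀: Coulomb/Higgs-type or a first-order endpoint with a critical point) ⇒ the universality bet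
is dead at one block scale: pivot #4 to a multi-scale (all j ≤ k) format or close
`refuted:RobustYangMillsRG`; FIRED ONCE ALREADY in the misstated class (2026-08-17, wild blocking;
repaired as rev 3). (iv) If HeavyBlockIntegration cannot place the blocked QCD density in the format
(dislocation bound fails: zero-mode dislocations proliferate per physical volume, or two-sided
sup-smallness of W off small fields is unachievable), pivot to a σ-dependent relative format or a
phase-quenched bridge with an explicit SignIrrelevance crux; if both fail in the abelian dry run
(cheapest falsifier), close `exhausted`. (v) FIRED 2026-08-16 (statement re-type p117723 added the
chiral clause `reg.IsChiralAtZero`): executed NOT as a close — the descent/transport routes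
(EulerDescent, whose HonestHeavyAnchor is the pinned threshold body) have not re-asked ThresholdQCD
/ ConstructiveDecouplingRG / RobustYangMillsRG / YMUniversality, and #2 RobustYangMills is wanted
only here, so closing now would moot the heavy anchor they consume — but as the explicit completion
node ChiralCompletion in `closes`. (v′) ¬ChiralCompletion in the same-regularisation form by an
honest heavy regularisation that does not continue (a weak-coupling lattice-artefact phase at FIXED
RGI mass above the corner surviving k → ∞) ⇒ class misstated: restate to the weaker ∃-regularisation
form `ThresholdQCD → QCD` (still decides) or add the missing trajectory clause; class substantive
(massless N_f = 2, 3 lattice QCD gapped, or no single mass-independent scheme serves light and heavy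
masses) ⇒ the conjunct as re-typed is itself in doubt — statement-level finding for the operator.
(v″) The descent family proves `QCDOf 2 ∧ QCDOf 3`, or re-asks the heavy bridge items as the
supplier of its anchor ⇒ close `superseded --by route-QuantumFields-EulerDescent` (heavy items
survive as shared). (vi) If the YangMills sub-problem converges on a rigid Wilson-only gap mechanism
with no stability margin, #4/#8 become "conditional on something nobody attacks" — dormant, not
closed.

NOT DECOMPOSED YET. Since the sixth repair: the support `RotationRestoration` (O(4) invariance of
subsequential OS limits of the isotropic blocked family — to be typed when #3 is split; items 13/15,
cruxes 7/7), the geometric coercivity lemma for a fat covariant averaging (rough block plaquette ⇒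
O(1) fine action in the two-block neighbourhood; flux/Cauchy–Schwarz) together with the definition
request for an exp/log or projected-mean `BlockMean` (BalabanSoftAveraging TODO), the optional
migration of #4's inline coercive class to a Literature `IsPrincipal` predicate over
`BalabanFormatDensity.densityWith` (D1″ has landed; its acceptance-test shape `∃ B :
LocalGaugeBlocking, … IsBlockingOfWith (backgroundAction B.link)` is exactly the refuted shape and
must NOT be used), and block-level positivity ∫|ρ|/∫ρ → 1 as a support if a refuter asks for it. The
glued split of ChiralCompletion (CornerPin / MassDescent / ChiralSoftness, or the re-ask of
EulerDescent's RayDescent / ChiralCornerSoftness / RetypedContinuumComplement once aligned with the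
unpinned anchor — tenure, after a crux closes or is sharpened by a refuter); the layer-2 split of
ConstructiveDecouplingRG (FermionicUVFlow, HeavyBlockIntegration, BridgeGlueOS); the migration of
#4's inline format to the requested Literature definition D1″ BalabanFormatDensity — whose principal
functional must be a PARAMETER instantiated by the fibre-infimum A_Bl, not the block Wilson action
(correction note attached to defn-BalabanFormatDensity) — then `--restate RobustYangMillsRG` 1:1
over it; the IsPrincipal fallback class; the pending clause-(iv′) restatement of the shared #2
(FLAG-clause-iv.md); the all-antiperiodic RP lemma and the per/ap comparison; the interleaving of
gauge and fermion block steps with uneven last blocks on odd tori; the source-dressing calculus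
(generating functionals through the blocked representation); the choice of engine in
HeavyBlockIntegration (loop soup vs. domain decomposition vs. Schur complements); OS reconstruction
details of the joint species family (E0′ growth); the multiplicative renormalisation of pseudoRe at
scale M₀; the diagonal-subsequence / equicontinuity-in-m step; every constant (c, η₀, β₀, M₀(η₀),
Δ). All are glued splits or `--supports` lemmas after a crux closes (D-0019), never a third layer.

CHEAPEST FALSIFIER. For #4 rev 3: (o) COERCIVITY OF FAT AVERAGING in the linearised abelian toy
already on the item (kit j020937/j020951: the fat principal kernel's small-q stiffness 1.14–1.19
against the block Laplacian ⇒ cA ≈ 1 on smooth fields; thin: top eigenvalue ≈ 5/b ⇒ fails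
eventually, as intended) and on ROUGH fields by the flux/Cauchy–Schwarz count (a block plaquette at
angle Θ forces Σθ_p ≥ Θ on most of the b² sheets ⇒ fine action ≥ cΘ²); a b-dependent cA → 0 for
honest averaging would empty the class of intended members (misdesign, not refutation); (i) the junk
templates against the coercive format — Haar / strong coupling (must fail on the quantised-flux
small-field configuration: βe cA ε ≤ 2B₀ per site is false beyond β₀), pull-backs h∘Bl and their
translation averages (must fail (h1) or lose the explicit push-forward), fixed-exponent / dial
blockings (must fail coercivity), fibre reweighting w·h with E[h|V] = 1 (invisible to the
block-level conclusion — no longer a refutation at all); (ii) PHYSICS: exhibit a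
reflection-positive, hypercubic, gauge-invariant lattice gauge–matter system whose matter integrates
out into an O(B₀) e^{−κ|X|}-quasi-local analytic remainder at scale ℓ₀ while the IR is massless
(Coulomb/Higgs) — the planner's check says broken-phase matter leaves power-law tails (eaten
Goldstones) and symmetric-phase heavy matter confines, so a survivor here is substantive news; any
survivor of (i) is a one-page refutation. For #3: the abelian / free dry run that needs no
Yang–Mills input — heavy Wilson electrons in lattice QED₄ or free Wilson fermions at bare mass a_kM
→ 0⁺: does BOS/Dimock block averaging reach block mass O(1) with a coercive block Dirac operator,
exponentially decaying kernels and a blocked determinant weight that is POSITIVE on small block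
fields, uniformly in k? And the lookup: the minimal Wilson action s_d of an SU(3) lattice
configuration carrying a real mode of D_W + m(k) below zero versus 16π²/11 (Göckeler et al. 1989,
Pugh–Teper 1989) — s_d ≤ 14.4 kills small-field positivity and SignIrrelevance at once. Lookup side
(done, negative = good for the line): no bulk transition on the SU(3) fundamental Wilson axis
(Creutz2022); `ledger negatives --problem QuantumFields` has nothing on this route's decls. For
ChiralCompletion: (α) paper — the Sharpe–Singleton dichotomy for Wilson N_f = 2 (Aoki phase of width
∼ a²Λ³ in the quark mass vs a first-order line with minimal pion mass ∼ aΛ²; SharpeSingleton1998):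
both branches are invisible at FIXED RGI m > 0 eventually in k and leave arbitrarily small gaps at
small positive m eventually in k, so neither refutes the typed clause (checked at planning); a
refutation needs an artefact phase at RGI distance O(1) above the corner surviving k → ∞ along an
asymptotically scaling trajectory — look for one in the N_f = 2, 3 Wilson phase-structure literature
(Aoki1984WilsonPhase, EdwardsHellerNarayanan1998, Creutz2022); (β) in-Lean — the tree's
`not_isChiralAtZero_iff_uniformLatticeGap` makes the chirality conjunct equivalent to 'no uniform
rate over all positive tuples of the re-pinned regularisation', so exhibiting, for one honest heavy
regularisation, a lattice gap bounded below uniformly down to and across the corner refutes the crux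
at once; (γ) the junk-regularisation template (pathological L_k, β_k, oscillating m_crit) dies on
the hypothesis, which demands honest IsQCDAlong data (sequential continuum limits, two-loop scaling)
above M₀. `ledger negatives` (4 entries, 2026-08-16T23Z) has nothing near it.

NUMBERS. b₀(N_f) = (11 − 2N_f/3)/(16π²): b₀(0) = 0.0697, b₀(2) = 0.0612, b₀(3) = 0.0570; 1 −
b₀(N_f)/b₀(0) = 2N_f/33 (0.121, 0.182), so Λ′ = Λ^{1−2N_f/33} M^{2N_f/33} at one loop
(CouplingMatching); massExponent N_f = γ₀/(2β₀) = 12/(33 − 2N_f) = 12/29, 4/9 (tree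
`massExponent_three`); tree normalisation β = 2/g₀² = β_W/3 (afBeta docstring, Creutz2022 (7.11)),
so the dislocation threshold reads 4b₀s_d > 4 ⇔ s_d(S_W units) > 16π²/11 ≈ 14.36 against the
instanton's S_W = 4π² ≈ 39.5 (ratio 0.36). Wilson fermions r = 1: free hopping radius κ < 1/8,
background-uniform radius |κ|·h < 1 with h = 16√3 (barrier HoppingExpansionUniformGap), i.e. |κ| <
0.036, while κ_c(g₀) = 1/8 + O(g₀²) > 1/8, i.e. m_crit(k) = −0.434 g₀(k)² + O(g₀⁴) < 0
(MontvayMunster1994 (5.62)) ≫ a_k m/Z_m(k) in modulus — why fine-lattice coercivity is unavailable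
on the physical trajectory and the expansion must wait for the block scale (κ_block = O(1/c)).
Rough-field bookkeeping behind the absolute format: expected number of cutoff-scale large plaquettes
per ℓ₀-block ≈ (ℓ₀Λ)⁴ e^{2/(b₀g_k²)} e^{−p₀(g_k)²/2} → ∞ (entropy beats quasi-polynomial
suppression), so earlier-scale large fields must be resummed into the analytic part and only
ℓ₀-rough regions carry F; on maximally rough blocks the fibre's smoothest interpolations cost β_k s
b_k² and the QCD/YM_{β_eff} log-ratio is +2(b₀(0)−b₀(N_f)) s b_k² log(b_k/c²). Range control
(W-pair): with (h4) a coupling at lattice distance n needs |X| ≥ n blocks, price e^{κn}, so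
admissible truncations decay at the physical rate κ/ℓ₀, consistent with (iii′) for Δ ≤ min(Δ_YM,
κ/ℓ₀). Refuter's blocking mismatch (rev-1 kill, absorbed by A_Bl in rev 2): R(0⁺) = b⁴ (IR match)
but R(q)/R(0⁺) ∈ [1.11, 3.94] (axial b = 2), [1.30, 10.8] (b = 4), [1.70, 25.5] (b = 8); [0.25,
0.96], [0.127, 0.95], [0.097, 0.948] (averaging b = 2, 4, 8); complex pole q* = (π, π, 2.2924i, 0):
Q̂² = 0, Q̂₀² + Q̂₁² = 8, min-alias |K̂²| = 2.54, 1.39, 0.83, 0.55, 0.39, 0.29, 0.22 for b = 2..8.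
Items after the fifth repair: 13 ≤ 15 — target ThresholdQCD, assembly (restated), 7 cruxes (#2
RobustYangMills, ChiralCompletion (rank 3), #4 RobustYangMillsRG, ConstructiveDecouplingRG (rank 5),
#5 HeavyLatticeGapFromYM, #7 YangMills, #8 YMUniversality; cap 7) and 4 supports (ThresholdShift ✓,
CouplingMatching ✓, YMLatticeGapAlongAFSequences, MassEquicontinuity informal). Cone: no new import
(D1 vocabulary on the block lattice, torus Haar inline), needs-fact NONE as before.

DEFINITION REQUESTS. D1 `QuasiLocalGaugePerturbation` — LANDED. D1′
`BlockScaleEffectivePerturbation` — LANDED (blocking of weights, large-field floor, Bałaban-format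
effective actions, bridge predicate); its relative bridge predicate and bounded-activity floor are
superseded for the condition by the absolute format of #4 (T1/T2 above). D2
`WilsonFermionBlockAveraging` — LANDED. LANDED 2026-08-16/17 (was pending): D1″
`BalabanFormatDensity` — NOTE after the sixth repair: #4 rev 3 stays INLINE; a migration must
quantify the principal functional over the coercive class through `densityWith`, never `∃ B :
LocalGaugeBlocking … backgroundAction B.link` (the refuted shape); original request text: D1″
`BalabanFormatDensity` (Literature/MathematicalPhysics/QuantumFieldTheory) — CORRECTED by this
repair: densities on the block torus of the form exp(−β A(V) − W(V))·F(LF_ε(V), V) with the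
principal functional A a PARAMETER of the format (instantiated for a blocking Bl from a fine torus
by the fibre-infimum A_Bl(V) = ⨅_{Bl U = V} S_W^{fine}(U), Bałaban (2.12)/(2.23); NOT the block
Wilson action), W ∈ D1 on the block lattice (HasAnalyticNormLE on smallFieldDomain, NormLE, range
control) and a rough-region set-function F (F(∅,·) = 1, |F(Z,·)| ≤ e^{c₀|Z|}, e^{−κn}-approximate
locality and factorisation over ℓ∞-separated parts), the local gauge-covariant blockings with evenly
spread corners from a fine torus of arbitrary side, the blocked-weight identity for signed fine
weights, and the algebra (format closed under products of F's / sums of W's; D1′'s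
HasBlockScaleEffectivePerturbation as the special case F ≡ 1, w ≥ 0) — Bałaban CMP 119
(2.17)–(2.23), (2.49); CMP 122 Thm 1; Dimock 2022 §3–4; Dobrushin-type quasi-locality — so that #4
can be restated 1:1 over it and HeavyBlockIntegration's output typed. OPTIONAL D1‴ `IsPrincipal`
(refuter's option (B), fallback only): a class of principal block functionals A (gauge-invariant,
lattice-symmetric, analytic on the r-domains, uniformly elliptic Hessian at flat connections,
range-controlled) over which #4 would quantify universally. Cite facts wanted: none.

Novelty: Searches (2026-08-15): `lit galaxy search "decoupling of heavy quarks" --star all` (3: Farhi–Jackiw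
reprint volume,
Williams QFT textbook, Harlander–Neumann gradient flow — none constructive); `lit galaxy search
"block renormalization
group for Euclidean fermions" --star all` (0); `lit galaxy search "Appelquist-Carazzone" --star pdf`
(5: EFT lecture notes
and phenomenology); `lit galaxy search "renormalization group approach to lattice gauge field
theories" --star all` (0);
`lit search --hybrid --source local "decoupling theorem heavy quark effective gauge theory matching
Lambda parameter
lattice"` (12 held textbooks: Collins 2011 PDF pp. 96–100 = §3.9–3.10 perturbative decoupling
theorem / LEET matching;
Montvay–Münster pp. 230, 260; Meyer-Ortmanns–Reisz p. 224; Donoghue–Golowich–Holstein pp. 210–217);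
`lit frontier
QuantumFields --since 2020` (30 rows: nothing fermionic-constructive; nearest arXiv:2401.10507
Chatterjee SU(2) YM–Higgs
Gaussian scaling limit, arXiv:2606.19362 an RP-construction claim for pure SU(N)); `lit bridges
QuantumFields --cross any`
(30 rows, Ising/percolation cluster, nothing on decoupling); remote cascade (OpenAlex/S2/arXiv)
partly unavailable this
session (searchd rc 75, arXiv HTTP 429 — logged in NOTES); plus the recorded searches of the card
and of the two
superseded cards (crossref "decoupling theorem heavy particles flow equations rigorous" →
Ball–Thorne 1995, Kopper:
perturbative only; galaxy bm25 "rigorous heavy quark decoupling on the lattice  [refs: 10.1006/aphy.1995.1067, 10.1007/978-3-7643-7434-1_12, 2401.10507, 2606.19362, doi:10.1006/aphy.1995.1067, doi:10.1007/978-3-7643-7434-1_12, AppelquistCarazzone1975, BalabanOcarrollSchor1989]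

Barriers (technique_class: heavy-threshold-decoupling, block-rg-with-fermions): - technique_class: heavy-threshold-decoupling, block-rg-with-fermions
- Literature.Barriers.QuantumFields.HoppingExpansionUniformGap: evaded by WHERE the
hopping/random-walk (or Schur) expansion is applied — on the block lattice of spacing ℓ₀ = c/M₀,
where the quark mass is O(c) in current units and the block hopping parameter is O(1/c), inside its
disc; never on the fine lattice, where κ_k → κ_c ≈ 1/8 as it must; the barrier's blocked conclusions
concern light hadrons, absent above the threshold.
- Literature.Barriers.QuantumFields.HoppingExpansionLocality: same evasion — background-uniform
locality of log det is claimed only after blocking (small-field regions of the block field), with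
large-field regions carried by Bałaban-type suppression, not by a uniform κ·h < 1 at the cutoff.
- Literature.Barriers.QuantumFields.LinearDivergenceRenormalon: m_crit(k) is defined
non-perturbatively inside the flow (stable-manifold / shooting argument scale by scale), not by a
(Borel-summed) series — the barrier's printed evasion; the residual O(a_kΛ) flavour-blind ambiguity
is exactly the free offset M₀.
- Literature.Barriers.QuantumFields.PerturbativeInvisibility: respected — no gap is extracted from
perturbation theory; Δ comes from RobustYangMills; perturbation theory with remainder is used only
for the coupling MATCHING and for non-decoupling at scale M₀ ≫ Λ, where g(M₀) is an honest small
parameter.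
- Literature.Barriers.QuantumFields.UVStabilityNonUniqueness: conceded for #3 (stabili

History (route lifecycle, newest last):
- 2026-08-16T06:54:27Z · rev 18: restated RobustYangMillsRG (stmt-QuantumFields-14660) — repair (4th crux-attack on this decl family): RobustYangMillsRG (stmt-QuantumFields-14660) refuted-misstated ON PAPER by refuter-rattack-stmt-QuantumFields-1466 (planner-rrefute-QuantumFields-HeavyThresholdYM-38b60152-0)
- 2026-08-16T23:34:54Z · rev 23: restated Assembly (stmt-QuantumFields-8798) — route-repair p117723 STEP 3b/3: restate the frame item Assembly 1:1 (same decl name) as ThresholdQCD → ChiralCompletion → QCD (provable now by the term of the c (planner-rrepair-QuantumFields-HeavyThresholdYM-6d6b7fd6-0)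
- 2026-08-17T01:45:03Z · BROKEN — RobustYangMillsRG (stmt-QuantumFields-14958, crux) refuted by Summit.QuantumFields.QCD.Theorems.not_RobustYangMillsRG @ 42cbf9ef150e (prover-line-stmt-QuantumFields-14958-c1-0)
- 2026-08-17T02:12:10Z · rev 24: restated RobustYangMillsRG (stmt-QuantumFields-14958 refuted) — repair (6th on this decl family): RobustYangMillsRG (stmt-QuantumFields-14958) refuted-misstated in Lean by Summit.QuantumFields.QCD.Theorems.not_RobustYangMill (planner-rfix-QuantumFields-HeavyThresholdYMB-0165b161-0)
- 2026-08-17T02:12:10Z · REPAIRED (restate RobustYangMillsRG) — back to open: repair (6th on this decl family): RobustYangMillsRG (stmt-QuantumFields-14958) refuted-misstated in Lean by Summit.QuantumFields.QCD.Theorems.not_RobustYangMill (planner-rfix-QuantumFields-HeavyThresholdYMB-0165b161-0)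
- 2026-08-24T19:54:42Z · DORMANT — reconciler: no traction for 7 d (last activity item-evidence-added at 2026-08-17T18:44:11Z); parked, not closed — `ledger route dormant route-QuantumFields-Heav (operator:999:3314067)
- 2026-08-28T21:17:59Z · REACTIVATED — reconciler: reactivated — activity statement-closed at 2026-08-28T19:02:51Z after parking at 2026-08-24T19:54:42Z (operator:999:2536577)
- 2026-09-04T23:38:04Z · DORMANT — reconciler: no traction for 5 d (last activity statement-checked at 2026-08-30T22:52:37Z); parked, not closed — `ledger route dormant route-QuantumFields-HeavyT (operator:999:3148543)

sub-problem: QCD · status: dormant · opened planner-plancard-QuantumFields-QCD-heavy-thre-f6813c1a-0 2026-08-15T13:33:33Z · rev 26 · ledger route-QuantumFields-HeavyThresholdYMBridge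
GENERATED by the gate from the ledger (D-0016/17). Provers cite these decls: `theorem foo : Summit.QuantumFields.QCD.Theses.HeavyThresholdYMBridge.<Decl> := …` in Summits/QuantumFields/QCD/Theorems/<Name>.lean.
-/

namespace Summit.QuantumFields.QCD.Theses.HeavyThresholdYMBridge

open scoped BigOperators Topology Manifold Classical MeasureTheory ProbabilityTheory Matrix InnerProductSpace ComplexConjugate ContinuousMap
open Filter Set Function TopologicalSpace MeasureTheory

attribute [summit_statement] _root_.QCD
attribute [route_premise "route-QuantumFields-HeavyThresholdYMBridge"] _root_.YangMills

/-- item stmt-QuantumFields-8794 · target · rank 0 · open · by planner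
why it might fail: Equivalent to QCDOf 2 ∧ QCDOf 3 itself (ThresholdShift one way, M₀ := 0 the other): existence + full-spectrum gap of 4D SU(3) gauge theory with dynamical quarks is open; via the bridge it contains robust SU(3) YM; flavour-blind m_crit may fail split masses beyond O(g₀⁴) sea effects.
sources: JaffeWitten2000, JaffeWittenClay2006, MontvayMunster1994, AppelquistCarazzone1975, BalabanOcarrollSchor1989
[target] for N_f ∈ {2, 3} there are M₀ ≥ 0 and a mass-independent regularisation reg with
HasMassScaling such that for every mass tuple with all m_f > M₀ there are species renormalisations
z, shift and OS data T with IsQCDAlong (reg.scheme m z shift) T, IsNontrivial and IsNonGaussian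
glue, IsNontrivial (pseudoRe f g) for all f ≠ g, and one Δ > 0 with T.HasMassGap Δ and (reg.scheme m
z shift).HasLatticeMassGap Δ — the threshold form of QCDOf 2 ∧ QCDOf 3 (card
heavy-threshold-robust-ym-bridge, thesis X). -/
@[route_item "route-QuantumFields-HeavyThresholdYMBridge"]
def ThresholdQCD : Prop :=
  ∀ Nf : ℕ, Nf = 2 ∨ Nf = 3 → ∃ M₀ : ℝ, 0 ≤ M₀ ∧ ∃ reg : Literature.MathematicalPhysics.QuantumFieldTheory.QCDRegularisation Nf, reg.HasMassScaling ∧ ∀ m : Fin Nf → ℝ, (∀ f, M₀ < m f) → ∃ (z shift : Literature.MathematicalPhysics.QuantumFieldTheory.QCDField Nf → ℕ → ℝ) (T : Literature.MathematicalPhysics.QuantumFieldTheory.OSData (Literature.MathematicalPhysics.QuantumFieldTheory.QCDField Nf) 4), Literature.MathematicalPhysics.QuantumFieldTheory.IsQCDAlong (reg.scheme m z shift) T ∧ T.IsNontrivial Literature.MathematicalPhysics.QuantumFieldTheory.QCDField.glue ∧ T.IsNonGaussian Literature.MathematicalPhysics.QuantumFieldTheory.QCDField.glue ∧ (∀ f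 g : Fin Nf, f ≠ g → T.IsNontrivial (Literature.MathematicalPhysics.QuantumFieldTheory.QCDField.pseudoRe f g)) ∧ ∃ Δ > 0, T.HasMassGap Δ ∧ (reg.scheme m z shift).HasLatticeMassGap Δ

-- earlier RobustYangMills (stmt-QuantumFields-13860, replaced 2026-08-15T22:17:59Z -> stmt-QuantumFields-13897): retired by None — open Literature.MathematicalPhysics.QuantumLattice Literature.MathematicalPhysics.AQFT Literature.MathematicalPhysics.QuantumFieldTheory in let G := ↥(Matrix.specialUnitaryGroup (Fin 3) ℂ); let ρ : G →* Matrix (Fin 3) (Fin 3) ℂ := fundamentalRep (Fin 3); let r₃ : Lattice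
-- earlier RobustYangMills (stmt-QuantumFields-8881, replaced 2026-08-15T21:32:17Z -> stmt-QuantumFields-13860): retired by None — [crux] RobustYangMills — THE NAMED CONDITION of this conditional bridge in its exact load-bearing form (registered conditional_on = `YangMills`; this crux is its ROBUST strengthening at G = SU(3); card K3; informal until definition request QuasiLocalGaugePerturbation land
/-- item stmt-QuantumFields-13897 · crux · rank 2 · open · by planner
why it might fail: Open ⊇ SU(3) YangMills ∧ #6: β- and action-universality of the gapped phase (incl. E1) for EVERY a.f. sequence and every RP, sup-small, range-controlled W; a Wilson-rigid gap proof gives nothing; (iv) needs clustering uniform along non-RP interpolations; universal η₀ may be too big at ℓ₀Λ′≈1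
sources: JaffeWitten2000, JaffeWittenClay2006, Balaban1988Convergent, Balaban1989LargeFieldII, DobrushinShlosman1985, DobrushinShlosman1987
[crux] RobustYangMills — rev 4, REPAIRED 2026-08-15 (2nd refuter crux-attack, class misstated,
witness W-pair: D1's weighted norm charges e^{κ|X|} by the NUMBER of blocks and D1 polymers need not
be connected, so range-S two-plaquette couplings −εJ·Q_p·Q_{p′} on ≤ 6 blocks were admissible and
gave connected plaquette correlations ≍ 1/S at time separation S, against the uniform-in-S lattice
gap (iii′); repaired as the refuter's C′ = rev-3 body + (h4)). OPENNESS OF THE GAPPED SU(3)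
YANG–MILLS PHASE in the coupling-relative, sup-small, RANGE-CONTROLLED quasi-local,
reflection-positive, lattice-symmetric action cone: there are η₀ > 0 and κ ≥ 0 (universal for SU(3),
Wilson/fundamental) such that for all scaling data (a_k → 0, a_k L_k → ∞), EVERY N_f = 0 two-loop
a.f. coupling sequence β′ (Λ′ > 0, β′_k − afBeta 0 Λ′ a_k → 0), every block scale ℓ₀ > 0 (b_k =
⌊ℓ₀/a_k⌋) and every family W = (W_{k,S}) in D1 `QuasiLocalGaugePerturbation 4 (2S+1) SU(3) b_k`
which, eventually in k and for all S ≥ L_k, (h1) has total invariant under ALL lattice translations,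
the time reflection and the axis permutations, (h2) gives a reflection-positive perturbed measure at
β′_k (D1 `IsReflectionPositive`), (h3) -/
@[route_item "route-QuantumFields-HeavyThresholdYMBridge"]
def RobustYangMills : Prop :=
  open Literature.MathematicalPhysics.QuantumLattice Literature.MathematicalPhysics.AQFT Literature.MathematicalPhysics.QuantumFieldTheory in let G := ↥(Matrix.specialUnitaryGroup (Fin 3) ℂ); let ρ : G →* Matrix (Fin 3) (Fin 3) ℂ := fundamentalRep (Fin 3); let r₃ : LatticeRep G := ⟨3, ρ, continuous_fundamentalRep _, fundamentalRep_injective _, fundamentalRep_mem_unitaryGroup⟩; ∃ η₀ : ℝ, 0 < η₀ ∧ ∃ κ : ℝ, 0 ≤ κ ∧ ∀ (a : ℕ → ℝ) (L : ℕ → ℕ) (ha : ∀ k, 0 < a k) (ha₀ : Filter.Tendsto a Filter.atTop (nhds 0)) (haL : Filter.Tendsto (fun k => a k * L k) Filter.atTop Filter.atTop) (β' : ℕ → ℝ) (Λ' : ℝ), 0 < Λ' → Filter.Tendsto (fun k => β' k - afBeta 0 Λ' (a k)) Filter.atTop (nhds 0) → ∀ ℓ₀ : ℝ, 0 < ℓ₀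 → let η : ℝ := η₀ / max 1 (afBeta 0 Λ' ℓ₀); let AdmAt : ((k : ℕ) → (S : ℕ) → QuasiLocalGaugePerturbation 4 (2 * S + 1) G ⌊ℓ₀ / a k⌋₊) → ℕ → Prop := fun W k => ∀ S : ℕ, L k ≤ S → (∀ (v : Site 4 (2 * S + 1)) (U : GaugeConfig 4 (2 * S + 1) G), (W k S).total (torusConfigShift v U) = (W k S).total U) ∧ (∀ U : GaugeConfig 4 (2 * S + 1) G, (W k S).total (GaugeConfig.timeReflect U) = (W k S).total U) ∧ (∀ (π : Equiv.Perm (Fin 4)) (U : GaugeConfig 4 (2 * S + 1) G), (W k S).total (fun e => U (e.1 ∘ π, π.symm e.2)) = (W k S).total U) ∧ (W k S).IsReflectionPositive ρ (β' k) ∧ (W k S).NormLE κ η ∧ (∀ X : Finset (Site 4 (2 * S + 1)), X ∈ polymers ⌊ℓ₀ / a k⌋₊ → (∃ U : GaugeConfig 4 (2 * S + 1) G, (W k S).act X U ≠ 0) → ∀ y ∈ X, ∀ y' ∈ X, ∀ i : Fin 4, (y i - y' i).val ≤ ⌊ℓ₀ / a k⌋₊ * X.card ∨ (y' i - y i).val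 ≤ ⌊ℓ₀ / a k⌋₊ * X.card); ∀ W, (∀ᶠ k in Filter.atTop, AdmAt W k) → ∃ φ : ℕ → ℕ, StrictMono φ ∧ ∃ (c m : YMSpecies G → ℕ → ℝ) (T : OSData (YMSpecies G) 4) (Δ : ℝ), 0 < Δ ∧ (∀ n : ℕ, n ≠ 0 → ∀ (σ : Fin n → YMSpecies G) (f : Fin n → SchwartzMap (EuclideanSpace ℝ (Fin 4)) ℝ) (F : SchwartzMap (Fin n → EuclideanSpace ℝ (Fin 4)) ℂ), IsTensorOf F (fun i => ofRealTest (f i)) → IsOffDiagonal F → Filter.Tendsto (fun j : ℕ => ((perturbedLatticeSchwinger ρ (⟨a, ha, ha₀, β', L, haL, c, m⟩ : SpeciesScheme (YMSpecies G)) (fun k => W k (L k)) (fun s => s.F) (φ j) n σ f : ℝ) : ℂ)) Filter.atTop (nhds (T.schwinger n σ F))) ∧ T.IsNontrivial r₃.curvature ∧ T.IsNonGaussian r₃.curvature ∧ T.HasMassGap Δ ∧ (∀ A B : YMSpecies G, ∃ C : ℝ, ∀ᶠ k in Filter.atTop, ∀ S : ℕ, L k ≤ S → ∀ n : ℕ,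 n ≤ S → |(W k S).connectedCorr ρ (β' k) A.F B.F n| ≤ C * Real.exp (-(Δ * (a k * n)))) ∧ (∀ (n : ℕ) (σ : Fin n → YMSpecies G) (f : Fin n → SchwartzMap (EuclideanSpace ℝ (Fin 4)) ℝ), ∃ C : ℝ, ∀ᶠ k in Filter.atTop, ∀ W', AdmAt W' k → ∀ δ : ℝ, 0 ≤ δ → (∀ S : ℕ, L k ≤ S → (W k S - W' k S).NormLE κ δ) → |perturbedLatticeSchwinger ρ (⟨a, ha, ha₀, β', L, haL, c, m⟩ : SpeciesScheme (YMSpecies G)) (fun k => W k (L k)) (fun s => s.F) k n σ f - perturbedLatticeSchwinger ρ (⟨a, ha, ha₀, β', L, haL, c, m⟩ : SpeciesScheme (YMSpecies G)) (fun k => W' k (L k)) (fun s => s.F) k n σ f| ≤ C * δ)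

/-- item stmt-QuantumFields-17661 · crux · rank 3 · open · by planner
why it might fail: Contains light-quark Wilson-lattice QCD: false if reg's trajectory meets a weak-coupling Aoki/first-order artefact at fixed RGI m>0 eventually in k (SharpeSingleton1998), if massless N_f=2,3 QCD is gapped (no Goldstone mode), or if m_crit has no convergent corner offset δ.
sources: SharpeSingleton1998, Aoki1984WilsonPhase, GasserLeutwyler1984, GellmannOakesRenner1968, MontvayMunster1994, tHooft1980Naturalness
[crux] ChiralCompletion — the LIGHT-QUARK COMPLETION made load-bearing by the statement re-type
p117723 (`QCDOf` ∧ `reg.IsChiralAtZero`; kill criterion (v) of this route realised: the audit-g7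
threshold shift no longer closes, tree `not_isChiralAtZero_mcrit_shift_of_uniformGapAbove`).
SAME-REGULARISATION form: for N_f ∈ {2,3}, EVERY mass-independent regularisation `reg` with
HasMassScaling that carries the full body of `QCDOf N_f` (IsQCDAlong, non-trivial non-Gaussian glue,
dynamical flavour-changing pseudoscalars, one Δ(m) > 0 for T.HasMassGap ∧ HasLatticeMassGap) at
every tuple above SOME threshold M₀ — the output of the heavy bridge, ThresholdQCD's witness —
carries it, after ONE constant re-pin of its flavour-blind critical mass m_crit(k) ↦ m_crit(k) + a_k
δ/Z_m(k) (δ ∈ ℝ = the RGI offset of the intrinsic chiral corner of reg's bare trajectory; stated as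
`reg.scheme (fun f => m f + δ)`), at EVERY positive tuple m, and is chiral at zero there (for every
ε > 0 some positive tuple has no uniform lattice gap ε). Content, three foreseen pieces (glued split
≤ 3 by tenure, preferably a re-ask of the descent family's decls — route EulerDescent: RayDescent /
ChiralCornerSoftness / Retyp -/
@[route_item "route-QuantumFields-HeavyThresholdYMBridge"]
def ChiralCompletion : Prop :=
  ∀ Nf : ℕ, Nf = 2 ∨ Nf = 3 → ∀ (reg : Literature.MathematicalPhysics.QuantumFieldTheory.QCDRegularisation Nf) (M₀ : ℝ), reg.HasMassScaling → (∀ m : Fin Nf → ℝ, (∀ f, M₀ < m f) → ∃ (z shift : Literature.MathematicalPhysics.QuantumFieldTheory.QCDField Nf → ℕ → ℝ) (T : Literature.MathematicalPhysics.QuantumFieldTheory.OSData (Literature.MathematicalPhysics.QuantumFieldTheory.QCDField Nf) 4), Literature.MathematicalPhysics.QuantumFieldTheory.IsQCDAlong (reg.scheme m z shift) T ∧ T.IsNontrivial Literature.MathematicalPhysics.QuantumFieldTheory.QCDField.glue ∧ T.IsNonGaussian Literature.MathematicalPhysics.QuantumFieldTheory.QCDField.glue ∧ (∀ f g : Fin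 Nf, f ≠ g → T.IsNontrivial (Literature.MathematicalPhysics.QuantumFieldTheory.QCDField.pseudoRe f g)) ∧ ∃ Δ > 0, T.HasMassGap Δ ∧ (reg.scheme m z shift).HasLatticeMassGap Δ) → ∃ δ : ℝ, (∀ ε > (0 : ℝ), ∃ m : Fin Nf → ℝ, (∀ f, 0 < m f) ∧ ¬ (reg.scheme (fun f => m f + δ) 0 0).HasLatticeMassGap ε) ∧ ∀ m : Fin Nf → ℝ, (∀ f, 0 < m f) → ∃ (z shift : Literature.MathematicalPhysics.QuantumFieldTheory.QCDField Nf → ℕ → ℝ) (T : Literature.MathematicalPhysics.QuantumFieldTheory.OSData (Literature.MathematicalPhysics.QuantumFieldTheory.QCDField Nf) 4), Literature.MathematicalPhysics.QuantumFieldTheory.IsQCDAlong (reg.scheme (fun f => m f + δ) z shift) T ∧ T.IsNontrivial Literature.MathematicalPhysics.QuantumFieldTheory.QCDField.glue ∧ T.IsNonGaussian Literature.MathematicalPhysics.QuantumFieldTheory.QCDField.glue ∧ (∀ f g : Fin Nf, f ≠ g → T.IsNontrivial (Literature.MathematicalPhysics.QuantumFieldTheory.QCDField.pseudoRe f g)) ∧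 ∃ Δ > 0, T.HasMassGap Δ ∧ (reg.scheme (fun f => m f + δ) z shift).HasLatticeMassGap Δ

-- earlier RobustYangMillsRG (stmt-QuantumFields-14660, replaced 2026-08-16T06:54:27Z -> stmt-QuantumFields-14958): retired by None — open Literature.MathematicalPhysics.QuantumLattice Literature.MathematicalPhysics.AQFT Literature.MathematicalPhysics.QuantumFieldTheory in let G := ↥(Matrix.specialUnitaryGroup (Fin 3) ℂ); let ρ : G →* Matrix (Fin 3) (Fin 3) ℂ := fundamentalRep (Fin 3); let r₃ : Latti
-- earlier RobustYangMillsRG (stmt-QuantumFields-14958, replaced 2026-08-17T02:12:10Z -> stmt-QuantumFields-17812): moot by None — open Literature.MathematicalPhysics.QuantumLattice Literature.MathematicalPhysics.AQFT Literature.MathematicalPhysics.QuantumFieldTheory in let G := ↥(Matrix.specialUnitaryGroup (Fin 3) ℂ); let ρ : G →* Matrix (Fin 3) (Fin 3) ℂ := fundamentalRep (Fin 3); let r₃ : LatticeR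
/-- item stmt-QuantumFields-17812 · crux · rank 4 · open · by planner
why it might fail: Open ⊇ volume-uniform gap of every weakly coupled coercive-format SU(3) block theory (universality; no IR transfer tool); sup-norm-uniform constants need ∫|ρ|/∫ρ control from the format; g-uniform (ε,r) vs Bałaban's α∼g(log g⁻²)^q; class may be empty if no fat averaging is certified.
sources: Balaban1988Convergent, Balaban1985Averaging, Balaban1984Propagators, Balaban1989LargeFieldII, Dimock2022QED3, DobrushinShlosman1987
[crux] RobustYangMillsRG — the NAMED CONDITION in its RG-level, consumable form, rev 3 (route-repair
2026-08-17 after the Lean refutation of rev 2, `not_RobustYangMillsRG`, class refuted-misstated: rev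
2 tied the principal part to the fibre-infimum A_Bl of an ∃-chosen blocking map constrained only by
measurability/covariance/locality, so a WILD measurable blocking (Haar→Haar shear, fibre infimum ≡
0) made the β = 0 Haar weight admissible for every β₀; the lead's repair-caveat showed `Continuous
Bl` still admits fixed-exponent cousins (label inflation), and the crux-ideate FINDINGS (A4 sub-ℓ₀
blindness, A5/F-E1 E1-dichotomy: hypercubic-anisotropic RP families are admissible iff the
consumers' format theorem holds, and then no SO(4)-invariant OSData is their limit) showed the
FINE/OS conclusions (i′),(ii) misstated for the class). REV 3 = refuter option (B) + block-level
conclusion: COERCIVE-FORMAT ROBUSTNESS OF THE GAPPED PHASE AT ONE BLOCK SCALE. For every choice of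
format constants (small-field threshold ε, analyticity radius r, remainder bound B₀ = O(1), decay
rate κ, rough-region allowance c₀, and NEW: coercivity constant cA and principal-norm bound A₀)
there is β₀ such that for -/
@[route_item "route-QuantumFields-HeavyThresholdYMBridge"]
def RobustYangMillsRG : Prop :=
  open Literature.MathematicalPhysics.QuantumLattice Literature.MathematicalPhysics.AQFT Literature.MathematicalPhysics.QuantumFieldTheory in let G := ↥(Matrix.specialUnitaryGroup (Fin 3) ℂ); let ρ : G →* Matrix (Fin 3) (Fin 3) ℂ := fundamentalRep (Fin 3); ∀ ε r B₀ κ c₀ cA A₀ : ℝ, 0 < ε → 0 < r → 0 < B₀ → 0 < κ → 0 < c₀ → 0 < cA → 0 < A₀ → ∃ β₀ : ℝ, 0 < β₀ ∧ ∀ (a : ℕ → ℝ) (L : ℕ → ℕ), (∀ k, 0 < a k) → Tendsto a atTop (nhds 0) → Tendsto (fun k => a k * L k) atTop atTop → ∀ ℓ₀ : ℝ, 0 < ℓ₀ → let b : ℕ → ℕ := fun k => ⌊ℓ₀ / a k⌋₊; let N : ℕ → ℕ := fun S => 2 * S + 1; let M : ℕ → ℕ → ℕ := fun k S => N S / b k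 - 1 + 1; let cor : (k S : ℕ) → Site 4 (M k S) → Site 4 (N S) := fun k S y i => ((N S * (y i).val / M k S : ℕ) : ZMod (N S)); let μ : (n : ℕ) → [NeZero n] → Measure (GaugeConfig 4 n G) := fun _ _ => Measure.pi fun _ => haarProbability G; let LF : (k S : ℕ) → GaugeConfig 4 (M k S) G → Finset (Site 4 (M k S)) := fun _ _ V => Finset.univ.filter fun y => ∃ i j : Fin 4, ε < 3 - (ρ (plaquetteHolonomy V y i j)).trace.re; let AdmAt : ((k S : ℕ) → GaugeConfig 4 (N S) G → ℝ) → (ℕ → ℝ) → ((k S : ℕ) → GaugeConfig 4 (N S) G → GaugeConfig 4 (M k S) G) → ℕ → ℕ → Prop := fun w βe Bl k S => Measurable (w k S) ∧ (0 < ∫ U, w k S U ∂(μ (N S))) ∧ (∀ g U, w k S (gaugeTransform g U) = w k S U) ∧ (∀ v U, w k S (torusConfigShift v U) = w k S U) ∧ (∀ U, w k S (GaugeConfig.timeReflect U) = w k S U) ∧ (∀ (π : Equiv.Perm (Fin 4)) U, w k S (U ∘ fun e => (e.1 ∘ π, π.symm e.2)) = w k S U) ∧ (∀ F : GaugeConfig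 4 (N S) G → ℝ, Measurable F → (∃ C, ∀ U, |F U| ≤ C) → IsPositiveTimeObservable F → 0 ≤ ∫ U, F U.timeReflect * F U * w k S U ∂(μ (N S))) ∧ Measurable (Bl k S) ∧ (∀ g U, Bl k S (gaugeTransform g U) = gaugeTransform (g ∘ cor k S) (Bl k S U)) ∧ (∀ e, DependsOn (fun U => Bl k S U e) {e' | ∀ i, (e'.1 i - cor k S e.1 i).val ≤ 5 * b k ∨ (cor k S e.1 i - e'.1 i).val ≤ 5 * b k}) ∧ ∃ (A W : QuasiLocalGaugePerturbation 4 (M k S) G 1) (F : Finset (Site 4 (M k S)) → GaugeConfig 4 (M k S) G → ℝ), A.HasAnalyticNormLE ρ (smallFieldDomain ρ 1 r ε) κ A₀ ∧ A.NormLE κ A₀ ∧ (∀ X ∈ polymers 1, (∃ V, A.act X V ≠ 0) → ∀ y ∈ X, ∀ y' ∈ X, ∀ i, (y i - y' i).val ≤ X.card ∨ (y' i - y i).val ≤ X.card) ∧ (∀ V, cA * wilsonAction ρ V ≤ A.total V - A.total fun _ => 1) ∧ W.HasAnalyticNormLE ρ (smallFieldDomain ρ 1 r ε) κ B₀ ∧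 W.NormLE κ B₀ ∧ (∀ X ∈ polymers 1, (∃ V, W.act X V ≠ 0) → ∀ y ∈ X, ∀ y' ∈ X, ∀ i, (y i - y' i).val ≤ X.card ∨ (y' i - y i).val ≤ X.card) ∧ (∀ Z, Measurable (F Z)) ∧ (∀ V, F ∅ V = 1) ∧ (∀ Z V, |F Z V| ≤ Real.exp (c₀ * Z.card)) ∧ (∀ Z (n : ℕ) V V', (∀ e, (∃ y ∈ Z, ∀ i, (e.1 i - y i).val ≤ n ∨ (y i - e.1 i).val ≤ n) → V e = V' e) → |F Z V - F Z V'| ≤ Real.exp (c₀ * Z.card + κ * (4 - n))) ∧ (∀ Z₁ Z₂ (n : ℕ), (∀ y ∈ Z₁, ∀ y' ∈ Z₂, ∃ i, n < (y i - y' i).val ∧ n < (y' i - y i).val) → ∀ V, |F (Z₁ ∪ Z₂) V - F Z₁ V * F Z₂ V| ≤ Real.exp (c₀ * (Z₁.card + Z₂.card) + κ * (4 - n))) ∧ ∀ Gf, Measurable Gf → (∃ C, ∀ V, |Gf V| ≤ C) → ∫ U, Gf (Bl k S U) * w k S U ∂(μ (N S)) = ∫ V, Gf V * (Real.exp (-(βe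 k * A.total V) - W.total V) * F (LF k S V) V) ∂(μ (M k S)); ∀ (w : (k S : ℕ) → GaugeConfig 4 (N S) G → ℝ) (βe : ℕ → ℝ) (Bl : (k S : ℕ) → GaugeConfig 4 (N S) G → GaugeConfig 4 (M k S) G), (∃ βl, Tendsto βe atTop (nhds βl)) → (∀ᶠ k in atTop, β₀ ≤ βe k ∧ ∀ S, L k ≤ S → AdmAt w βe Bl k S) → let E : (k S : ℕ) → (GaugeConfig 4 (N S) G → ℝ) → ℝ := fun k S h => (∫ U, h U * w k S U ∂(μ (N S))) / ∫ U, w k S U ∂(μ (N S)); ∃ Δ : ℝ, 0 < Δ ∧ ∀ h : ℕ, ∃ C : ℝ, ∀ᶠ k in atTop, ∀ S, L k ≤ S → ∀ (t : ℕ) (G₁ G₂ : GaugeConfig 4 (M k S) G → ℝ) (C₁ C₂ : ℝ), 2 * t ≤ M k S → Measurable G₁ → Measurable G₂ → (∀ V, |G₁ V| ≤ C₁) → (∀ V, |G₂ V| ≤ C₂) → DependsOn G₁ {e | (e.1 0).val < h} → DependsOn G₂ {e | (e.1 0).val < h} → |E k S (fun U => G₁ (Bl k S U) * G₂ (torusConfigShift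 (Pi.single 0 (t : ZMod (M k S))) (Bl k S U))) - E k S (fun U => G₁ (Bl k S U)) * E k S (fun U => G₂ (torusConfigShift (Pi.single 0 (t : ZMod (M k S))) (Bl k S U)))| ≤ C * C₁ * C₂ * Real.exp (-(Δ * (ℓ₀ * t)))

/-- item stmt-QuantumFields-14667 · crux · rank 5 · open · by planner
why it might fail: Block-fermion RG with dynamical SU(3) in d=4 never built; needs a certified FAT covariant averaging with coercivity cA·S_W(Bl U) ≤ S_W(U) (none in tree); since #4 rev 3 also the fine leg: fibre decoupling, transfer-matrix gap, OS limit WITH O(4) restoration (no theorem); det³ positivity.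
sources: AppelquistCarazzone1975, BalabanOcarrollSchor1989, Dimock2022QED3, Balaban1988Convergent, Balaban1985Averaging, GawedzkiKupiainenMasslessLattice1985
[crux] ConstructiveDecouplingRG — the QCD-SIDE HALF of the thesis, RE-POINTED to the RG level
(route-repair 2026-08-16; supersedes the dropped D1-level node ConstructiveDecoupling :=
RobustYangMills → ThresholdQCD, stmt-QuantumFields-14372, refuted-misstated by
refuter-rattack-stmt-QuantumFields-14372: on the trajectory m_crit(k) ≈ −0.434 g₀² < 0 the
fermion-integrated weight e^{−β_kS_W}∏_f det D_W(U, m_f(k)) vanishes on SU(3)^E (Adams 2001 index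
transcripts + continuity), is signed for N_f = 3 / split masses and carries O(1) cutoff-scale terms
per fine plaquette, so no element of D1's bounded sup-small fine-lattice cone is at bounded
log-density distance and #2 was consumable only at W ≡ 0): RobustYangMillsRG (#4) ⟹ ThresholdQCD
(#0). Content = constructive scale-wise heavy-quark decoupling (Appelquist–Carazzone made
constructive) delivered INTO THE FORMAT OF #4: for each N_f ∈ {2,3}, threshold M₀ and tuple m > M₀
the gauge marginal of lattice QCD with Wilson fermions ANTIPERIODIC IN ALL FOUR DIRECTIONS
(hypercubic-symmetric and link-RP; site-RP from m_f(k) > −1, the statement's own clause) —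
w_{k,S}(U) = e^{−β_k S_W(U)} ∏_f det D_W^{ap}(U, m_f(k)), signed, real — satisfies (h1) ∧ -/
@[route_item "route-QuantumFields-HeavyThresholdYMBridge"]
def ConstructiveDecouplingRG : Prop :=
  RobustYangMillsRG → ThresholdQCD

/-- item stmt-QuantumFields-8795 · crux · rank 5 · open · by planner
why it might fail: The (a,L)-instantiated hypothesis covers only Wilson-action measures at N_f=0-profile couplings: no ACTION-direction robustness (−N_f log det is quasi-local at scale 1/M₀), no control of C(A,B); in effect the unconditional heavy-Wilson-quark lattice gap at weak coupling, uniform in volume.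
sources: HasenfratzDegrand1994, AppelquistCarazzone1975, BrunoEtAl2015HeavySea, Balaban1988Convergent, BalabanOcarrollSchor1989, JaffeWitten2000
[crux] the lattice-gap SHADOW of the bridge, typed over existing declarations: for N_f ∈ {2, 3} and
scaling data (a_k → 0, a_k L_k → ∞), IF lattice SU(3) Yang–Mills (Wilson, fundamental) has a
uniform-in-volume lattice gap along EVERY N_f = 0 asymptotically scaling coupling sequence β′ on
these spacings (the hypothesis is YMLatticeGapAlongAFSequences at (a, L)), THEN there is a QCD
regularisation reg on the same (a, L), asymptotically scaling with b₀(N_f), b₁(N_f) and with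
HasMassScaling, and a threshold M₀, such that for every mass tuple above M₀ the lattice
full-spectrum gap clause (reg.scheme m z shift).HasLatticeMassGap Δ holds for some Δ = Δ(m) > 0 (all
z, shift). Mechanism: FermionicUVFlow + HeavyBlockIntegration turn lattice QCD at (β_k, m(k)) into
Wilson YM at the matched a.f. sequence β_eff(k; m) (CouplingMatching) plus a small quasi-local W_k;
the hypothesis supplies the gap along β_eff(·; m); quark-carrying channels follow from the heavy
quark-line representation. Deliberately outside the Assembly (calibration / refutation rung). [deps:
YMLatticeGapAlongAFSequences, CouplingMatching] [difficulty: open-problem] -/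
@[route_item "route-QuantumFields-HeavyThresholdYMBridge"]
def HeavyLatticeGapFromYM : Prop :=
  ∀ Nf : ℕ, Nf = 2 ∨ Nf = 3 → ∀ (a : ℕ → ℝ) (L : ℕ → ℕ), (∀ k, 0 < a k) → Filter.Tendsto a Filter.atTop (nhds 0) → Filter.Tendsto (fun k => a k * L k) Filter.atTop Filter.atTop → (∀ β' : ℕ → ℝ, (∃ Λ' : ℝ, 0 < Λ' ∧ Filter.Tendsto (fun k => β' k - Literature.MathematicalPhysics.QuantumFieldTheory.afBeta 0 Λ' (a k)) Filter.atTop (nhds 0)) → ∃ Δ' : ℝ, 0 < Δ' ∧ ∀ A B : Literature.MathematicalPhysics.QuantumFieldTheory.YMSpecies (Matrix.specialUnitaryGroup (Fin 3) ℂ), ∃ C : ℝ, ∀ᶠ k in Filter.atTop, ∀ S : ℕ, L k ≤ S → ∀ n : ℕ, n ≤ S → |Literature.MathematicalPhysics.QuantumFieldTheory.latticeConnectedCorr (Literature.MathematicalPhysics.QuantumLattice.fundamentalRep (Fin 3)) (β' k) (2 * S + 1) A.F B.F n| ≤ C * Real.exp (-(Δ' * (a k * n)))) → ∃ reg : Literature.MathematicalPhysics.QuantumFieldTheory.QCDRegularisation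 Nf, reg.a = a ∧ reg.L = L ∧ reg.HasMassScaling ∧ (reg.scheme 0 0 0).HasAsymptoticScaling ∧ ∃ M₀ : ℝ, 0 ≤ M₀ ∧ ∀ m : Fin Nf → ℝ, (∀ f, M₀ < m f) → ∃ Δ > 0, ∀ z shift : Literature.MathematicalPhysics.QuantumFieldTheory.QCDField Nf → ℕ → ℝ, (reg.scheme m z shift).HasLatticeMassGap Δ

/-- item stmt-QuantumFields-14093 · crux · rank 7 · open · by planner
why it might fail: It is the Clay Yang–Mills problem itself (existence + full-spectrum gap of 4D Yang–Mills for EVERY compact simple G; open even for G = SU(3)); a trivial, Gaussian or gapless continuum limit for one G, or no OS limit along any sequential scheme, kills it.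
sources: JaffeWitten2000, JaffeWittenClay2006, Balaban1989LargeFieldII, OsterwalderSeilerAnnPhys1978
[crux] YangMills — the REGISTERED CONDITION of this conditional bridge, now LISTED as a crux (D-0027
§2.2 bridge-only hold 2026-08-16: "bridges can be part of the summit, but the summit route must
encompass the entire summit"): the sibling conjunct `_root_.YangMills` of the summit VERBATIM
(Jaffe–Witten 2000 §4: for every compact simple Lie group G a faithful unitary lattice
representation r, a sequential scaling scheme, OS data T for all gauge-invariant local observables
with IsYangMillsFor r sch T, non-trivial non-Gaussian curvature, and one Δ > 0 with T.HasMassGap Δ ∧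
HasLatticeMassGap r sch Δ). Consumed by this route ONLY at G = SU(3) and only through crux #8
YMUniversality: RobustYangMills (#2) ⇐ YangMills ∧ YMUniversality by modus ponens (term-checked in
the planner sketch, `robustYangMills_of`); conversely #2 already implies the SU(3)
fundamental-Wilson package along every sequence (landed
`Theorems/RobustYangMills/Negative/NoSmallFalse.lean`, `robustYangMills_imp_wilson`). YM-SIDE like
#6: it IS the YangMills sub-problem and is attacked through Summits/QuantumFields/YangMills/Theses/*
— NOT a task for this route's provers (planner holds the item against duplicate staffing); -/
@[route_item "route-QuantumFields-HeavyThresholdYMBridge"]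
def YangMills : Prop :=
  _root_.YangMills

-- earlier YMUniversality (stmt-QuantumFields-14097, replaced 2026-08-16T05:39:33Z -> stmt-QuantumFields-14668): retired by None — YangMills → RobustYangMills
/-- item stmt-QuantumFields-14668 · crux · rank 8 · open · by planner
why it might fail: A sparse ∃-witness of YangMills (its own r, β_j, L_j) need not transfer to every coercive-format block theory; no IR transfer tool; sup-norm-uniform slab clustering is transfer-matrix-grade for block laws that are not exactly RP; β₀ uniform in ℓ₀ is an extra universality claim.
sources: Balaban1988Convergent, Balaban1989LargeFieldII, DobrushinShlosman1987, FriedliVelenik2017, JaffeWitten2000, OsterwalderSeilerAnnPhys1978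
[crux] YMUniversality — universality / robustness TRANSFER to the RG-LEVEL condition (route-repair
2026-08-16: restated 1:1 under the same decl name; the D1-level reading YangMills → RobustYangMills,
stmt-QuantumFields-14097, is retired together with its consumer, the dropped D1-level
ConstructiveDecoupling): IF `YangMills` holds — so at G = SU(3), via the Literature fact
isSimpleCompactGroup_specialUnitaryGroup, Wilson's lattice theory in SOME faithful unitary
representation r has, along SOME sequential two-loop a.f. scheme, a gapped non-trivial non-Gaussian
OS continuum limit with a lattice gap — THEN RobustYangMillsRG (#4): for every format constants
there is a block-coupling threshold β₀ beyond which every Bałaban-format family at every block scale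
ℓ₀ (signed reflection-positive hypercubic fine weights whose ℓ₀-blocked density is exp(−βe_k A(V) −
W(V))·F(LF(V), V) with two-sided sup-small analytic W and local approximately factorising
rough-region factor F) has the package (subsequential OS limit of all fine gauge-invariant species,
non-trivial non-Gaussian curvature, one Δ > 0 for HasMassGap and for the clustering of all fine
gauge-invariant local observables uniformly in the -/
@[route_item "route-QuantumFields-HeavyThresholdYMBridge"]
def YMUniversality : Prop :=
  YangMills → RobustYangMillsRG

/-- item stmt-QuantumFields-8796 · support · rank 6 · open · by planner
why it might fail: Asserts the SU(3) Wilson lattice gap, uniform over all tori S ≥ L_k, as β → ∞ along EVERY two-loop a.f. sequence: lattice half of the Millennium YM gap (rigorous gaps only at strong coupling, cluster expansion) plus β-universality, which a subsequential construction does not give.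
sources: JaffeWitten2000, JaffeWittenClay2006, OsterwalderSeilerAnnPhys1978, SeilerLNP1982, Balaban1988Convergent, Creutz2022
[crux] the β-direction of the named condition, typed: for all scaling data (a_k > 0, a_k → 0, a_k
L_k → ∞) and EVERY coupling sequence β′ obeying N_f = 0 two-loop asymptotic scaling (∃ Λ′ > 0, β′_k
− afBeta 0 Λ′ a_k → 0), lattice SU(3) Yang–Mills with Wilson's action in the fundamental
representation has a lattice gap Δ′ > 0 in the units set by a_k, uniformly in the volume: for all
gauge-invariant local observables A, B there is C with |⟨A · τ_{n e₀} B⟩ − ⟨A⟩⟨B⟩| ≤ C e^{−Δ′ a_k n}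
on every torus of side 2S + 1 ≥ 2L_k + 1, n ≤ S, eventually in k. It is the lattice half of
`YangMills` at G = SU(3) strengthened from ∃ scheme to ∀ asymptotically scaling Wilson sequence —
the universality in the coupling that the bridge consumes because the matched sequences β_eff(·; m)
are not ours to choose. Not for provers now (YM-side); typed so refuters can sharpen the condition
early. [difficulty: open-problem] -/
@[route_item "route-QuantumFields-HeavyThresholdYMBridge"]
def YMLatticeGapAlongAFSequences : Prop :=
  ∀ (a : ℕ → ℝ) (L : ℕ → ℕ), (∀ k, 0 < a k) → Filter.Tendsto a Filter.atTop (nhds 0) → Filter.Tendsto (fun k => a k * L k) Filter.atTop Filter.atTop → ∀ β' : ℕ → ℝ, (∃ Λ' : ℝ, 0 < Λ' ∧ Filter.Tendsto (fun k => β' k - Literature.MathematicalPhysics.QuantumFieldTheory.afBeta 0 Λ' (a k)) Filter.atTop (nhds 0)) → ∃ Δ' : ℝ, 0 < Δ' ∧ ∀ A B : Literature.MathematicalPhysics.QuantumFieldTheory.YMSpecies (Matrix.specialUnitaryGroup (Fin 3) ℂ), ∃ C : ℝ, ∀ᶠ k in Filter.atTop, ∀ S : ℕ, L k ≤ S → ∀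 n : ℕ, n ≤ S → |Literature.MathematicalPhysics.QuantumFieldTheory.latticeConnectedCorr (Literature.MathematicalPhysics.QuantumLattice.fundamentalRep (Fin 3)) (β' k) (2 * S + 1) A.F B.F n| ≤ C * Real.exp (-(Δ' * (a k * n)))

/-- item stmt-QuantumFields-8699 · support · rank 9 · closed · proved by Summit.QuantumFields.QCD.Theorems.thresholdShift_proof (prover) · by planner
sources: MontvayMunster1994, JaffeWitten2000
[support] (assembly glue, the statement's audit-g7 shift; provable now) for every `reg` and M₀ there
is `reg'` (same a, β, L, Z_m; m_crit'(k) = m_crit(k) + a_k M₀/Z_m(k)) with `reg.HasMassScaling →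
reg'.HasMassScaling` and `reg'.scheme m z shift = reg.scheme (m + M₀) z shift` for all m, z, shift.
[difficulty: provable-now] -/
@[route_item "route-QuantumFields-HeavyThresholdYMBridge"]
def ThresholdShift : Prop :=
  ∀ (Nf : ℕ) (reg : Literature.MathematicalPhysics.QuantumFieldTheory.QCDRegularisation Nf) (M₀ : ℝ), ∃ reg' : Literature.MathematicalPhysics.QuantumFieldTheory.QCDRegularisation Nf, (reg.HasMassScaling → reg'.HasMassScaling) ∧ ∀ (m : Fin Nf → ℝ) (z shift : Literature.MathematicalPhysics.QuantumFieldTheory.QCDField Nf → ℕ → ℝ), reg'.scheme m z shift = reg.scheme (fun f => m f + M₀) z shift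

/-- `ThresholdShift` holds: proved by `Summit.QuantumFields.QCD.Theorems.thresholdShift_proof`. -/
theorem ThresholdShift_holds : ThresholdShift := _root_.Summit.QuantumFields.QCD.Theorems.thresholdShift_proof

/-- item stmt-QuantumFields-8797 · support · rank 9 · closed · proved by Summit.QuantumFields.QCD.Theorems.couplingMatching_proof @ dbfd7adbb054 (prover) · by planner
sources: Collins2011PQCD, MontvayMunster1994, AppelquistCarazzone1975
[support] decoupling/matching arithmetic for the tree's two-loop profile afBeta (absorbed from
heavy-corner-robust-ym-bridge P1, corrected: the naive difference afBeta N_f Λ a − afBeta 0 Λ′ a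
DIVERGES like log a): for all N_f, Λ > 0, M > 0 there is Λ′ > 0 (namely log Λ′² = [b₀(N_f) log Λ² +
(b₀(0) − b₀(N_f)) log M²]/b₀(0), i.e. Λ′ = Λ^{1−2N_f/33} M^{2N_f/33}) such that afBeta 0 Λ′ a −
[afBeta N_f Λ a + 2(b₀(0) − b₀(N_f)) log(1/(a²M²)) + 2(b₁(0)/b₀(0) − b₁(N_f)/b₀(N_f)) log
log(1/(a²Λ²))] → 0 as a → 0⁺: the one-loop heavy-threshold log plus the two-loop log-log swap
convert N_f-flavour asymptotic scaling of β_k into N_f = 0 asymptotic scaling of the matched β_eff.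
Pure real analysis (log of a ratio of logs → 0). [difficulty: provable-now] -/
@[route_item "route-QuantumFields-HeavyThresholdYMBridge"]
def CouplingMatching : Prop :=
  ∀ (Nf : ℕ) (Λ M : ℝ), 0 < Λ → 0 < M → ∃ Λ' : ℝ, 0 < Λ' ∧ Filter.Tendsto (fun a : ℝ => Literature.MathematicalPhysics.QuantumFieldTheory.afBeta 0 Λ' a - (Literature.MathematicalPhysics.QuantumFieldTheory.afBeta Nf Λ a + 2 * (Literature.MathematicalPhysics.QuantumFieldTheory.betaCoeff₀ 0 - Literature.MathematicalPhysics.QuantumFieldTheory.betaCoeff₀ Nf) * Real.log (1 / (a ^ 2 * M ^ 2)) + 2 * (Literature.MathematicalPhysics.QuantumFieldTheory.betaCoeff₁ 0 / Literature.MathematicalPhysics.QuantumFieldTheory.betaCoeff₀ 0 - Literature.MathematicalPhysics.QuantumFieldTheory.betaCoeff₁ Nf / Literature.MathematicalPhysics.QuantumFieldTheory.betaCoeff₀ Nf) * Real.log (Real.log (1 / (a ^ 2 * Λ ^ 2))))) (nhdsWithin 0 (Set.Ioi 0)) (nhds 0)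

-- `CouplingMatching` holds: proved by `Summit.QuantumFields.QCD.Theorems.couplingMatching_proof` @ dbfd7adbb054 (its module imports this route file, so no `_holds` link can be stated here).

-- item stmt-QuantumFields-8884 · support · rank 9 · open · by planner — informal only, no Lean statement yet:
--   [support] MassEquicontinuity — the ∃ reg ∀ m quantifier order (threshold-window-bridge E5; cf. card
--   arzela-ascoli-in-the-quark-mass, NOT imported as a mechanism): the statement asks ONE sequence of
--   spacings to serve uncountably many mass tuples. Either (a) the expansions of
--   FermionicUVFlow/HeavyBlockIntegration together with RobustYangMills (iv) give genuine limits per m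
--   (expected for the quark sector in the convergent heavy regime), or (b) the smeared lattice n-point
--   functionals m ↦ S_k(m; n, σ, f) are equi-Lipschitz on compacts of (M₀, ∞)^{N_f} uniformly in k (mass
--   derivative = (a_k/Z_m(k))

-- earlier Assembly (stmt-QuantumFields-8798, replaced 2026-08-16T23:34:54Z -> stmt-QuantumFields-17764): retired by None — ThresholdQCD → ThresholdShift → QCD
/-- item stmt-QuantumFields-17764 · assembly · rank 1 · closed · proved by Summit.QuantumFields.QCD.Theorems.heavyThresholdYMBridge_assembly_proof (prover) · by planner
sources: JaffeWitten2000, MontvayMunster1994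
[assembly] ThresholdQCD → ChiralCompletion → QCD — the frame statement X → Statement after the
statement re-type p117723 (`QCDOf` ∧ `reg.IsChiralAtZero`): the heavy-corner thesis plus the
light-quark completion decide the conjunct; provable now by the term of `closes` (apply
ChiralCompletion to ThresholdQCD's (reg, M₀), re-pin m_crit by a_k δ/Z_m(k), `ring`). Supersedes the
pre-re-type frame ThresholdQCD → ThresholdShift → QCD, whose shift can no longer supply the
chirality of the shifted regularisation (tree `not_isChiralAtZero_mcrit_shift_of_uniformGapAbove`).
[difficulty: provable-now] -/
@[route_item "route-QuantumFields-HeavyThresholdYMBridge"]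
def Assembly : Prop :=
  ThresholdQCD → ChiralCompletion → QCD

-- `Assembly` holds: proved by `Summit.QuantumFields.QCD.Theorems.heavyThresholdYMBridge_assembly_proof` (its module imports this route file, so no `_holds` link can be stated here).

/-! D-0027 §2.1 — DECIDING THEOREM (planner-authored via `route open/edit --closes-file`; by planner-rrepair-QuantumFields-HeavyThresholdYM-6d6b7fd6-0 2026-08-16T23:27:14Z):
its hypotheses are this route's items and its conclusion the sub-problem Statement (glue_lint), and it elaborates with this file. -/

/-- D-0027 §2.1 deciding theorem — CRUX-ONLY form, re-elaborated against the re-typed statement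
(route-repair 2026-08-16, statement re-type p117723: `QCDOf N_f := ∃ reg, HasMassScaling ∧
IsChiralAtZero ∧ ∀ m > 0, body`). The registered condition `YangMills` (crux #7, the sibling conjunct
verbatim) and the universality/robustness transfer `YMUniversality` (crux #8) give the consumable
RG-level condition `RobustYangMillsRG` (crux #4) by modus ponens; the constructive-decoupling node
`ConstructiveDecouplingRG` (crux, rendered at rank 5) turns it into the heavy-corner thesis
`ThresholdQCD` (target #0): per `N_f` a threshold `M₀`, ONE regularisation `reg` with `HasMassScaling`
and the full body above `M₀`. The former proof then absorbed `M₀` by the audit-g7 shift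
`m_crit(k) ↦ m_crit(k) + a_k M₀/Z_m(k)` — no longer possible: the shifted regularisation must now be
CHIRAL AT ZERO, which the shift cannot supply (tree `not_isChiralAtZero_mcrit_shift_of_uniformGapAbove`).
The light-quark completion node `ChiralCompletion` (crux, rank 3) applied to `(reg, M₀)` gives the
corner offset `δ`, chirality at zero and the body at EVERY positive tuple of the `δ`-re-pinned
regularisation `{reg with mcrit := m_crit(k) + a_k δ/Z_m(k)}` (its scheme at `m` is `reg`'s scheme at
`m + δ`, by `ring`; `HasMassScaling` reads only `a, Z_m`), which is literally the witness
`⟨reg_δ, HasMassScaling, IsChiralAtZero, body⟩` of the re-typed `QCDOf N_f`; `N_f = 2` and `3` give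
`QCD`. From a direct proof `h4 : RobustYangMillsRG` the same term closes with `hD h4` in place of
`hD (hU hYM)`. Pure logic + `ring`; axioms propext / Classical.choice / Quot.sound. -/
@[closes "route-QuantumFields-HeavyThresholdYMBridge"] theorem closes (hD : ConstructiveDecouplingRG) (hYM : YangMills) (hU : YMUniversality)
    (hC : ChiralCompletion) : QCD := by
  have hT : ThresholdQCD := hD (hU hYM)
  have key : ∀ Nf : ℕ, (Nf = 2 ∨ Nf = 3) → QCDOf Nf := by
    intro Nf hNf
    obtain ⟨M₀, -, reg, hms, hbody⟩ := hT Nf hNf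
    obtain ⟨δ, hchi, hall⟩ := hC Nf hNf reg M₀ hms hbody
    have hsch : ∀ (m : Fin Nf → ℝ) (z shift : Literature.MathematicalPhysics.QuantumFieldTheory.QCDField Nf → ℕ → ℝ),
        ({ reg with mcrit := fun k => reg.mcrit k + reg.a k * δ / reg.Zm k } :
            Literature.MathematicalPhysics.QuantumFieldTheory.QCDRegularisation Nf).scheme m z shift =
          reg.scheme (fun f => m f + δ) z shift := by
      intro m z shift
      simp only [Literature.MathematicalPhysics.QuantumFieldTheory.QCDRegularisation.scheme,
        Literature.MathematicalPhysics.QuantumFieldTheory.QCDScheme.mk.injEq, true_and, and_true]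
      funext f k
      ring
    refine ⟨{ reg with mcrit := fun k => reg.mcrit k + reg.a k * δ / reg.Zm k }, hms, ?_, fun m hm => ?_⟩
    · intro ε hε
      obtain ⟨m, hm, hng⟩ := hchi ε hε
      refine ⟨m, hm, ?_⟩
      rw [hsch m 0 0]
      exact hng
    · obtain ⟨z, shift, T, hrest⟩ := hall m hm
      refine ⟨z, shift, T, ?_⟩
      rw [hsch m z shift]
      exact hrest
  exact ⟨key 2 (Or.inl rfl), key 3 (Or.inr rfl)⟩

end Summit.QuantumFields.QCD.Theses.HeavyThresholdYMBridge
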